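import Mathlib
import Literature.MathematicalPhysics.QuantumFieldTheory.Balaban1983to89.B5ActionRate166

/-!
# Bałaban [B5] (1.99)–(1.103): the Landau-gauge multiplier `QGQ*(p′)`, its explicit inverse
# `(QGQ*)⁻¹(p′) = a·I + D_k(p′)`, the bounds (1.100)–(1.101), and their η-RATES — per fibre `p′ ≠ 0`,
# unit lattice, `U = 1`

Cell `pub-balaban`, node U1a (spine estimate NE2: η-rate of the LINEAR theory), seat P1 (technique: transfer
of the scalar rate to the Landau-gauge-vector layer through the propagator representations of [B5] §1),
generation 2.  Generation 1 is `B5ActionRate166` (the rate `C_φ·N⁻²` of the scalar primitive `Δ₀φ^{(1.62)}`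
and of the (1.66) weight `w`); this module puts the VECTOR / LANDAU-GAUGE layer of [B5] §1 — formulas
(1.83)–(1.86) and (1.99)–(1.103) — on top of it, at the level of momentum MULTIPLIERS.

## Honest framing (read first)

* Everything here is a statement about `d × d` complex matrices and real scalars indexed by a reduced momentum
  `p′ = s ∈ [−π,π]^d` with `p′ ≠ 0` (binders `hs : ∀ κ, |s κ| ≤ π`, `ν₀`, `hν₀ : s ν₀ ≠ 0` throughout) and by
  the number `n = L^k ≥ 1` of fine points per coarse point (`[NeZero n]`, `hn : 1 ≤ n`); `a > 0` (or `a ≥ 0`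
  where stated) is the averaging constant; `U = 1` (linear theory, no background field).  §8 is on a finite
  unit torus `T_M = Π_μ ℤ/M_μ`, arbitrary `M_μ ≥ 1`.
* NOT constructed / NOT claimed: the operators `G`, `H_k`, `Q`, `R`, `QGQ*` on `L²(T_η)` / `T₁^{(k)}`; the
  identity (1.65) = (1.66); (1.103) `H_kB = GQ*(QGQ*)⁻¹B` as an operator identity (it needs (1.93)–(1.98),
  `R∂*GQ* = 0`, which are not typed here); the strip / analytic continuation (seat P2's `T4GaugeActionRateStrip`);
  anything with a background field (NE2⁺), the non-linear theory, the continuum or infinite-volume limits, a mass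
  gap.  Nothing of the T⁴ spine is discharged by this file; its value is a kernel-certified multiplier layer.
* `[cite: …]` tags mark the LOCATION of a transcribed printed formula (three `def`s: `sigma199`, `qgq`, `m101`);
  every `theorem` is kernel-proved from the tree and tagged `[folklore]`, with the printed locator in prose when
  it proves a printed claim.  No hypothesis of any theorem is an unproved published statement; the constants
  (`γ₀ = (4/π²)^{d+2}`, `C_φ = π²/12 + 1/3`, `C_E = γ₀⁻² + 3γ₀⁻⁶`) are ours and not optimal.

## Citation header (verbatim print, [B5] = Bałaban, Commun. Math. Phys. 95 (1984) 17–40, key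
`Balaban1984PropagatorsI`; renders `HOME/b2b-balaban-ref1/pages/1984-cmp95-propagators-rt-I/…-p015/p016/p018-x2.png`
read as images; `≦`/`≧` reproduced as printed)

* p.31: «To investigate better the operator G we write it in momentum representation:» — (1.83), whose third
  group of terms carries the scalar factor `a⁻¹(Σ_λ |∂_{1,λ}(p′)|²/φ_λ(p′))⁻¹` between the two square brackets —
  «for p′ ≠ 0, Ã_μ(l) = (1/Δ(l))J̃_μ(l), Ã_μ(0) = a⁻¹J̃_μ(0), where»
  (1.84) «φ_μ(p′) = 1 + aΣ_{l″}|u(p′+l″)|²|v_μ(p′+l″)|²/Δ(p′+l″) for p′ ≠ 0.»  (tree: `B5Prop11Leaves.phiMu`,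
  `= 1 + a·φ^{(1.62)}` by `B5Bounds167Lattice.phiMu_eq_one_add`).  Same page: «It is easy to see that ∂₁*φ⁻¹∂₁
  is positive also because φ⁻¹ is positive, so φ⁻¹ ≧ α > 0 and ∂₁*φ⁻¹∂₁ ≧ α∂₁*∂₁ = αΔ₀ > 0.»
* p.32: (1.85) «Δ₀(p′)φ_μ(p′) = Δ₀(p′) + aΣ_{l″}|u(p′+l″)|²|v_μ(p′+l″)|²Δ₀(p′)/Δ(p′+l″)» «has a limit as
  p′ → 0, lim Δ₀(p′)φ_μ(p′) = a, and it is bounded from below and above by positve constants independent of k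
  and depending on d and a only. From this it follows that the function» (1.86)
  «Σ_λ |∂_{1,λ}(p′)|²/(Δ₀²(p′)φ_λ(p′))» «has the same property, hence also its inverse.» (tree:
  `B5Prop11Leaves.q186`, `ineq185_*`, `ineq186`); and, on the third term of (1.83), «This factor multiplying the
  function between the square bracket expressions gives an inverse of the expression (1.86) which is also well
  defined.»
* p.34: «so we have to investigate the operator QGQ*. It is given by the formula»
  (1.99) «QGQ* = a⁻¹I − a⁻¹φ⁻¹ + a⁻¹φ⁻¹∂₁(∂₁*φ⁻¹∂₁)⁻¹∂₁*φ⁻¹,» «and can be bounded as follows»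
  (1.100) «a⁻¹(φ − 1)φ⁻¹ ≦ QGQ* ≦ a⁻¹I.» «The operator a⁻¹(φ − 1)/φ has the momentum representation»
  (1.101) «a⁻¹(φ_μ(p′) − 1)/φ_μ(p′) = Σ_{l′}|u(p′+l′)|²|v_μ(p′+l′)|²Δ₀(p′)/Δ(p′+l′) / (Δ₀(p′) +
  aΣ_{l′}|u(p′+l′)|²|v_μ(p′+l′)|²Δ₀(p′)/Δ(p′+l′)),» «from which it follows that it is bounded from below and
  above by positive constants dependent on d only (for a = 1). The same property holds for QGQ*. The condition
  QA = B gives the equation» (1.102) «− QGQ*ω = B, − ω = (QGQ*)⁻¹B,» «so finally we get the representation»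
  (1.103) «H_kB = GQ*(QGQ*)⁻¹B.» «This representation allows us to reduce a proof of properties of H_k to the
  corresponding properties of G.»

## What is here (all `p′ ≠ 0` in the zone; `y := Δ₀φ^{(1.62)} ∈ [γ₀,1]^d` is the sibling's box variable `xIn`)

* §0–§2  The second box variable `z_μ := (Δ₀ + a·y_μ)/(Δ₀ + a) = Δ₀φ_μ^{(1.84)}/(Δ₀+a) ∈ [γ₀,1]` and its rate
  `|z^{(N)} − z^{(RN)}| ≤ (a/(Δ₀+a))·Δ₀·C_φ·N⁻²` (`zIn_rate`); the matrix function
  `E(p′;x)_{μν} := δ_{μν}/x_μ − ∂¹_μ conj ∂¹_ν/(τ(x) x_μ x_ν)`, `τ(x) := Σ_λ|∂¹_λ|²/x_λ`, Hermitian, with entry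
  bound `γ⁻¹ + γ⁻²` and box-Lipschitz constant `γ⁻² + 3γ⁻⁶` on `[γ,1]^d` (`norm_Emat_le`, `Emat_lipschitz`, from
  the sibling's `sig_bounds`/`sig_lipschitz`); its quadratic form by a weighted Lagrange identity:
  `⟨w,E(x)w⟩ = (2τ)⁻¹Σ_{μν}|∂¹_μw_ν − ∂¹_νw_μ|²/(x_μx_ν) ∈ [0, Σ|w_μ|²/x_μ]` (`qform_Emat_lagrange`,
  `qform_Emat_nonneg`, `qform_Emat_le`).
* §3  (1.99) transcribed per fibre (`qgq`, three printed terms) and the representation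
  `QGQ*(p′) = a⁻¹(I − (Δ₀/(Δ₀+a))·E(p′; z))` (`qgq_eq_Emat`); Hermitian; the two halves of (1.100) as
  quadratic-form inequalities on `ℂ^d` (`ineq1100_lower`, `ineq1100_upper`); (1.101) (`m101`, `m101_eq`) with the
  explicit two-sided bounds `γ₀/(4d+a) ≤ m_μ ≤ (Δ₀+a)⁻¹ ≤ a⁻¹` (`m101_bounds`) and the `a`-free rate `C_φN⁻²`
  (`m101_rate`).
* §4  `D_k(p′)_{μν} := δ_{μν}/φ_μ^{(1.62)} − ∂¹_μ conj ∂¹_ν·w^{(1.66)}_{μν}` (`DeltaKfib`) `= Δ₀·E(p′; y)`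
  (`DeltaKfib_eq_Emat`), `(QGQ*)⁻¹(p′) := a·I + D_k(p′)` (`qgqInv`), and the KERNEL-CHECKED
  `QGQ*(p′)·(a·I + D_k(p′)) = I = (a·I + D_k(p′))·QGQ*(p′)`, `Matrix.inv (QGQ*(p′)) = a·I + D_k(p′)`
  (`qgq_mul_qgqInv`, `qgqInv_mul_qgq`; an explicit Sherman–Morrison identity `sm_mul_eq_one`) — a cross-check
  of the transcribed (1.99) against the printed weight of (1.66); `(QGQ*)⁻¹ ≥ a·I`, `0 ≤ D_k ≤ diag(1/φ^{(1.62)})`.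
* §5  η-rates of the scalar multipliers: (1.84) `a·C_φN⁻²`, `1/φ_μ` `a·C_φN⁻²`, (1.85) `a·Δ₀·C_φN⁻²`,
  (1.86) `= (Σ_λ a_λ/z_λ)/(Δ₀+a)` with bounds `[(Δ₀+a)⁻¹, γ₀⁻¹(Δ₀+a)⁻¹]` and rate, its inverse
  `≤ 4d·a·γ₀⁻²C_φN⁻²`, `σ₉₉ = Δ₀²·q₁₈₆` and the rate of the regularised middle factor `Δ₀²/σ₉₉` of (1.83)/(1.88).
* §6  Uniform entry bounds of `QGQ*`, `D_k`, `(QGQ*)⁻¹` (`norm_entries_le`) and the entrywise η-RATES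
  `‖QGQ*^{(N)}(p′) − QGQ*^{(RN)}(p′)‖ ≤ (Δ₀/(Δ₀+a))²·C_E·C_φ·N⁻² ≤ C_E·C_φ·N⁻²` (`qgq_rate`, `a`-free) and
  `‖(QGQ*)⁻¹^{(N)} − (QGQ*)⁻¹^{(RN)}‖ = ‖D_k^{(N)} − D_k^{(RN)}‖ ≤ Δ₀²·C_E·C_φ·N⁻² ≤ 16d²·C_E·C_φ·N⁻²`
  (`qgqInv_rate`), for ALL `N, R ≥ 1`, uniformly in `p′ ≠ 0`.
* §7  The sibling's conditional rate of the two `p′`-factors of (1.63) with its hypothesis discharged by gen-1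
  (`inverse_factors_rate_discharged`).
* §8  `⟨w, D_k(p′)w⟩ = ½Σ_{μν} w^{(1.66)}_{μν}(p′)|∂¹_μw_ν − ∂¹_νw_μ|²` and hence, on every unit torus,
  `formDk n M B = Σ_{p : p′ ≠ 0} ⟨B̂(p′), D_k(p′)B̂(p′)⟩` (`formDk_eq_sum_fibre`): the (1.66) form of the tree IS
  the direct sum of the fibre forms of `(QGQ*)⁻¹(p′) − a·I` — the multiplier-level content behind (1.102)–(1.103).

## What is NOT claimed (besides the framing above)

(1) that `qgq` is the matrix of the operator `QGQ*` of (1.98)–(1.99) in any basis — it is the fibrewise reading of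
the printed formula with `φ ↦ diag(φ_μ(p′))`, `∂₁ ↦ (∂¹_μ(p′))_μ`, `∂₁* ↦ conj`, stated as a definition;
(2) the `p′ = 0` class (there `φ_μ`, `w`, `D_k` take junk values; §8 shows it carries no (1.66)-weight);
(3) optimality of any constant; (4) any statement for `U ≠ 1`.
-/

noncomputable section

namespace Literature.MathematicalPhysics.QuantumFieldTheory.Balaban1983to89.B5QGQ199Rate

open scoped BigOperators ComplexConjugate Matrix
open Finset Real
open Literature.MathematicalPhysics.QuantumFieldTheory.Balaban1983to89.B4Strip
open Literature.MathematicalPhysics.QuantumFieldTheory.Balaban1983to89.B5Prop11Leaves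
open Literature.MathematicalPhysics.QuantumFieldTheory.Balaban1983to89.B5Prop11Fiber
open Literature.MathematicalPhysics.QuantumFieldTheory.Balaban1983to89.B5Prop11Plancherel
open Literature.MathematicalPhysics.QuantumFieldTheory.Balaban1983to89.B5Bounds167Lattice
open Literature.MathematicalPhysics.QuantumFieldTheory.Balaban1983to89.T4GaugeActionRate
  (sig aW xIn gam0 gam0_pos gam0_le_one xIn_mem_box w166_eq_sig aW_nonneg sum_aW_eq_one mean_bounds
   abs_inv_sub_inv_le inv_lipschitz_on_box abs_mean_sub_mean_le invMean_lipschitz sig_bounds sig_lipschitz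
   inverse_factors_rate)
open Literature.MathematicalPhysics.QuantumFieldTheory.Balaban1983to89.B5ActionRate166
  (Cphi Cphi_pos phi162_rate Delta0_phi162_rate hphi_discharged Crate Crate_nonneg)
open Literature.MathematicalPhysics.QuantumFieldTheory.Balaban1983to89.Beta.SymbolExpansion (S1r_pos)

variable {d : ℕ}

/-! ## §0 The punctured zone, the box `[γ₀,1]^d`, and the second box variable `z` -/

section Zone

/-- one term of `Δ₀ = Σ_λ S₁(p′_λ)` is at most the sum. [folklore] -/
theorem S1r_le_Delta1r (s : Fin d → ℝ) (μ : Fin d) : S1r (s μ) ≤ Delta1r 0 s := by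
  unfold Delta1r
  rw [add_zero]
  exact Finset.single_le_sum (f := fun κ => S1r (s κ)) (fun κ _ => S1r_nonneg (s κ)) (Finset.mem_univ μ)

/-- `|∂¹_μ(p′)|·|∂¹_ν(p′)| ≤ Δ₀(p′)` (`ab ≤ (a² + b²)/2`, `|∂¹_λ|² = S₁(p′_λ) ≤ Δ₀`). [folklore] -/
theorem norm_d1Sym_mul_le (s : Fin d → ℝ) (μ ν : Fin d) :
    ‖d1Sym s μ‖ * ‖d1Sym s ν‖ ≤ Delta1r 0 s := by
  have h1 : ‖d1Sym s μ‖ ^ 2 ≤ Delta1r 0 s := by rw [norm_d1Sym_sq]; exact S1r_le_Delta1r s μ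
  have h2 : ‖d1Sym s ν‖ ^ 2 ≤ Delta1r 0 s := by rw [norm_d1Sym_sq]; exact S1r_le_Delta1r s ν
  nlinarith [sq_nonneg (‖d1Sym s μ‖ - ‖d1Sym s ν‖), norm_nonneg (d1Sym s μ), norm_nonneg (d1Sym s ν)]

/-- on the punctured zone `φ_μ^{(1.62)}(p′) > 0` (indeed `Δ₀φ_μ ≥ γ₀`). [folklore] -/
theorem phi162_pos (n : ℕ) [NeZero n] (hn : 1 ≤ n) (s : Fin d → ℝ) (hs : ∀ κ, |s κ| ≤ π)
    (ν₀ : Fin d) (hν₀ : s ν₀ ≠ 0) (μ : Fin d) : 0 < phi162 n μ s := by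
  have hx := (xIn_mem_box n hn s hs ν₀ hν₀ μ).1
  have hγ := gam0_pos d
  have hΔ := Delta1r_pos s hs ν₀ hν₀
  unfold xIn at hx
  by_contra h
  have h' : phi162 n μ s ≤ 0 := not_lt.mp h
  have : Delta1r 0 s * phi162 n μ s ≤ 0 := mul_nonpos_iff.mpr (Or.inl ⟨hΔ.le, h'⟩)
  linarith

/-- **the second box variable** `z_λ(p′) := (Δ₀ + a·Δ₀φ_λ^{(1.62)})/(Δ₀ + a)` — the variable in which the
Landau-gauge multipliers (1.84), (1.99) become the SAME matrix function as (1.66) (§3): `1/φ_μ^{(1.84)} =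
(Δ₀/(Δ₀+a))·z_μ⁻¹`. [folklore] -/
def zIn (n : ℕ) (a : ℝ) (s : Fin d → ℝ) (κ : Fin d) : ℝ :=
  (Delta1r 0 s + a * xIn n s κ) / (Delta1r 0 s + a)

/-- `z_λ ∈ [γ₀, 1]` on the punctured zone for `a ≥ 0` (from `Δ₀φ_λ ∈ [γ₀,1]`, `γ₀ ≤ 1`). [folklore] -/
theorem zIn_mem_box (n : ℕ) [NeZero n] (hn : 1 ≤ n) (a : ℝ) (ha : 0 ≤ a) (s : Fin d → ℝ)
    (hs : ∀ κ, |s κ| ≤ π) (ν₀ : Fin d) (hν₀ : s ν₀ ≠ 0) (κ : Fin d) :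
    gam0 d ≤ zIn n a s κ ∧ zIn n a s κ ≤ 1 := by
  obtain ⟨hlo, hhi⟩ := xIn_mem_box n hn s hs ν₀ hν₀ κ
  have hΔ := Delta1r_pos s hs ν₀ hν₀
  have hγ1 := gam0_le_one d
  have hD : 0 < Delta1r 0 s + a := by linarith
  unfold zIn
  constructor
  · rw [le_div_iff₀ hD]
    nlinarith
  · rw [div_le_one hD]
    nlinarith

/-- the two box variables move together: `z_λ − z′_λ = (a/(Δ₀+a))·(Δ₀φ_λ − Δ₀φ′_λ)`. [folklore] -/
theorem zIn_sub (n n' : ℕ) (a : ℝ) (s : Fin d → ℝ) (κ : Fin d) :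
    zIn n a s κ - zIn n' a s κ = a / (Delta1r 0 s + a) * (xIn n s κ - xIn n' s κ) := by
  unfold zIn
  rw [← sub_div]
  ring

/-- **η-rate of `z`**: `|z^{(N)}_λ − z^{(RN)}_λ| ≤ (a/(Δ₀+a))·Δ₀·C_φ·N⁻²` (gen-1 `Delta0_phi162_rate`). [folklore] -/
theorem zIn_rate {N R : ℕ} [NeZero N] [NeZero R] (hN : 1 ≤ N) (hR : 1 ≤ R) (a : ℝ) (ha : 0 ≤ a)
    (s : Fin d → ℝ) (hs : ∀ κ, |s κ| ≤ π) (ν₀ : Fin d) (hν₀ : s ν₀ ≠ 0) (κ : Fin d) :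
    |zIn N a s κ - zIn (R * N) a s κ|
      ≤ a / (Delta1r 0 s + a) * (Delta1r 0 s * (Cphi * ((N : ℝ) ^ 2)⁻¹)) := by
  have hΔ := Delta1r_pos s hs ν₀ hν₀
  have hD : 0 < Delta1r 0 s + a := by linarith
  rw [zIn_sub, abs_mul, abs_of_nonneg (div_nonneg ha hD.le)]
  refine mul_le_mul_of_nonneg_left ?_ (div_nonneg ha hD.le)
  rw [abs_sub_comm]
  exact Delta0_phi162_rate hN hR κ s hs ν₀ hν₀

/-- the prefactor `(a/(Δ₀+a))·Δ₀ ≤ Δ₀ ≤ 4d`, so `|z^{(N)} − z^{(RN)}| ≤ 4d·C_φ·N⁻²` as well. [folklore] -/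
theorem zIn_rate' {N R : ℕ} [NeZero N] [NeZero R] (hN : 1 ≤ N) (hR : 1 ≤ R) (a : ℝ) (ha : 0 ≤ a)
    (s : Fin d → ℝ) (hs : ∀ κ, |s κ| ≤ π) (ν₀ : Fin d) (hν₀ : s ν₀ ≠ 0) (κ : Fin d) :
    |zIn N a s κ - zIn (R * N) a s κ| ≤ 4 * d * (Cphi * ((N : ℝ) ^ 2)⁻¹) := by
  refine le_trans (zIn_rate hN hR a ha s hs ν₀ hν₀ κ) ?_
  have hΔ := Delta1r_pos s hs ν₀ hν₀
  have hD : 0 < Delta1r 0 s + a := by linarith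
  have h4 := Delta1r_le s
  have hC : 0 ≤ Cphi * ((N : ℝ) ^ 2)⁻¹ := by have := Cphi_pos; positivity
  have h1 : a / (Delta1r 0 s + a) ≤ 1 := by rw [div_le_one hD]; linarith
  calc a / (Delta1r 0 s + a) * (Delta1r 0 s * (Cphi * ((N : ℝ) ^ 2)⁻¹))
      ≤ 1 * (4 * d * (Cphi * ((N : ℝ) ^ 2)⁻¹)) :=
        mul_le_mul h1 (mul_le_mul_of_nonneg_right h4 hC) (by positivity) zero_le_one
    _ = 4 * d * (Cphi * ((N : ℝ) ^ 2)⁻¹) := one_mul _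

end Zone

/-! ## §1 ONE matrix function on the box: `E(p′; x)` -/

section EMatrix

/-- `τ(p′; x) := Σ_λ S₁(p′_λ)/x_λ = Σ_λ |∂¹_λ(p′)|²/x_λ` (`= Δ₀·T(x)` with the sibling's mean `T = Σ a_λ/x_λ`).
[folklore] -/
def tauX (s x : Fin d → ℝ) : ℝ := ∑ κ, S1r (s κ) / x κ

/-- **`E(p′; x)_{μν} := δ_{μν}/x_μ − ∂¹_μ(p′)·conj ∂¹_ν(p′)/(τ(p′;x)·x_μ·x_ν)`** — a `d × d` complex matrix for
each momentum `p′` and each point `x` of the box; (1.66), (1.99) and (1.102)'s inverse are all affine images of it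
(§3–§4).  Symbol convention: `∂¹_μ(p′) = e^{ip′_μ} − 1` (`B5Prop11Fiber.d1Sym`), the adjoint `∂¹*` has the
conjugate symbol. [folklore] -/
def Emat (s x : Fin d → ℝ) : Matrix (Fin d) (Fin d) ℂ := fun μ ν =>
  (if μ = ν then (((1 / x μ : ℝ)) : ℂ) else 0)
    - d1Sym s μ * conj (d1Sym s ν) * ((1 / (tauX s x * x μ * x ν) : ℝ) : ℂ)

/-- `τ(p′;x) = Δ₀(p′)·T(x)`, `T(x) = Σ_λ a_λ(p′)/x_λ` (the sibling's weights `aW`). [folklore] -/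
theorem tauX_eq (s x : Fin d → ℝ) (hΔ : Delta1r 0 s ≠ 0) :
    tauX s x = Delta1r 0 s * ∑ κ, aW s κ / x κ := by
  unfold tauX aW
  rw [Finset.mul_sum]
  refine Finset.sum_congr rfl fun κ _ => ?_
  field_simp

/-- the off-diagonal coefficient is the sibling's `σ(a;x)/Δ₀`: `1/(τ x_μ x_ν) = sig (aW p′) x μ ν / Δ₀(p′)`.
[folklore] -/
theorem coeff_eq_sig (s x : Fin d → ℝ) (hΔ : Delta1r 0 s ≠ 0) (μ ν : Fin d) :
    1 / (tauX s x * x μ * x ν) = sig (aW s) x μ ν / Delta1r 0 s := by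
  rw [tauX_eq s x hΔ]
  unfold sig
  field_simp

/-- `τ ≥ Δ₀ > 0` on the box (`T ≥ 1`). [folklore] -/
theorem tauX_pos {γ : ℝ} (hγ : 0 < γ) (s x : Fin d → ℝ) (hΔ : 0 < Delta1r 0 s)
    (hx : ∀ κ, γ ≤ x κ ∧ x κ ≤ 1) : Delta1r 0 s ≤ tauX s x ∧ 0 < tauX s x := by
  have hT := (mean_bounds (aW s) x γ hγ (aW_nonneg s) (sum_aW_eq_one s hΔ.ne') hx).1
  rw [tauX_eq s x hΔ.ne']
  constructor
  · calc Delta1r 0 s = Delta1r 0 s * 1 := (mul_one _).symm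
      _ ≤ Delta1r 0 s * ∑ κ, aW s κ / x κ := mul_le_mul_of_nonneg_left hT hΔ.le
  · exact mul_pos hΔ (lt_of_lt_of_le one_pos hT)

/-- `E` is Hermitian: `E(p′;x)ᴴ = E(p′;x)`. [folklore] -/
theorem Emat_conjTranspose (s x : Fin d → ℝ) : (Emat s x)ᴴ = Emat s x := by
  ext μ ν
  rw [Matrix.conjTranspose_apply]
  unfold Emat
  rw [Complex.star_def, map_sub, map_mul, map_mul, Complex.conj_conj, Complex.conj_ofReal,
    apply_ite (starRingEnd ℂ), Complex.conj_ofReal, map_zero]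
  by_cases h : μ = ν
  · subst h; ring
  · have h' : ¬ ν = μ := fun e => h e.symm
    rw [if_neg h, if_neg h', show tauX s x * x ν * x μ = tauX s x * x μ * x ν by ring]
    ring

/-- **entry bound** `‖E(p′;x)_{μν}‖ ≤ γ⁻¹ + γ⁻²` on the box `[γ,1]^d`, `0 < γ`, `p′ ≠ 0`
(`1/x_μ ≤ γ⁻¹`; `|∂_μ∂_ν| ≤ Δ₀` and `σ ≤ γ⁻²` by the sibling's `sig_bounds`). [folklore] -/
theorem norm_Emat_le {γ : ℝ} (hγ : 0 < γ) (s x : Fin d → ℝ) (hΔ : 0 < Delta1r 0 s)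
    (hx : ∀ κ, γ ≤ x κ ∧ x κ ≤ 1) (μ ν : Fin d) :
    ‖Emat s x μ ν‖ ≤ 1 / γ + 1 / γ ^ 2 := by
  have hσ := (sig_bounds (aW s) x γ hγ (aW_nonneg s) (sum_aW_eq_one s hΔ.ne') hx μ ν).2
  have hσ0 : 0 ≤ sig (aW s) x μ ν :=
    le_trans hγ.le (sig_bounds (aW s) x γ hγ (aW_nonneg s) (sum_aW_eq_one s hΔ.ne') hx μ ν).1
  have hxμ : 0 < x μ := lt_of_lt_of_le hγ (hx μ).1
  -- diagonal part
  have hdiag : ‖(if μ = ν then (((1 / x μ : ℝ)) : ℂ) else 0)‖ ≤ 1 / γ := by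
    split_ifs
    · rw [Complex.norm_real, Real.norm_eq_abs, abs_of_pos (by positivity)]
      exact one_div_le_one_div_of_le hγ (hx μ).1
    · simp; positivity
  -- off-diagonal part
  have hoff : ‖d1Sym s μ * conj (d1Sym s ν) * ((1 / (tauX s x * x μ * x ν) : ℝ) : ℂ)‖ ≤ 1 / γ ^ 2 := by
    rw [norm_mul, norm_mul, Complex.norm_conj, Complex.norm_real, Real.norm_eq_abs,
      coeff_eq_sig s x hΔ.ne' μ ν, abs_of_nonneg (div_nonneg hσ0 hΔ.le)]
    calc ‖d1Sym s μ‖ * ‖d1Sym s ν‖ * (sig (aW s) x μ ν / Delta1r 0 s)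
        ≤ Delta1r 0 s * (sig (aW s) x μ ν / Delta1r 0 s) :=
          mul_le_mul_of_nonneg_right (norm_d1Sym_mul_le s μ ν) (div_nonneg hσ0 hΔ.le)
      _ = sig (aW s) x μ ν := by field_simp
      _ ≤ 1 / γ ^ 2 := hσ
  unfold Emat
  exact le_trans (norm_sub_le _ _) (add_le_add hdiag hoff)

/-- **Lipschitz bound** on the box: for `0 < γ ≤ 1`, `x, x′ ∈ [γ,1]^d` with `|x_λ − x′_λ| ≤ δ` (all `λ`) and
`p′ ≠ 0`, `‖E(p′;x)_{μν} − E(p′;x′)_{μν}‖ ≤ (γ⁻² + 3γ⁻⁶)·δ` — the sibling's `inv_lipschitz_on_box` and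
`sig_lipschitz` BY NAME. [folklore] -/
theorem Emat_lipschitz {γ δ : ℝ} (hγ : 0 < γ) (hγ1 : γ ≤ 1) (s x x' : Fin d → ℝ) (hΔ : 0 < Delta1r 0 s)
    (hx : ∀ κ, γ ≤ x κ ∧ x κ ≤ 1) (hx' : ∀ κ, γ ≤ x' κ ∧ x' κ ≤ 1) (hδ : ∀ κ, |x κ - x' κ| ≤ δ)
    (μ ν : Fin d) :
    ‖Emat s x μ ν - Emat s x' μ ν‖ ≤ (1 / γ ^ 2 + 3 / γ ^ 6) * δ := by
  have hδ0 : 0 ≤ δ := le_trans (abs_nonneg _) (hδ μ)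
  have ha0 := aW_nonneg s
  have ha1 := sum_aW_eq_one s hΔ.ne'
  -- diagonal part
  have hdiag : ‖(if μ = ν then (((1 / x μ : ℝ)) : ℂ) else 0) - (if μ = ν then (((1 / x' μ : ℝ)) : ℂ) else 0)‖
      ≤ 1 / γ ^ 2 * δ := by
    split_ifs
    · rw [← Complex.ofReal_sub, Complex.norm_real, Real.norm_eq_abs]
      exact inv_lipschitz_on_box x x' γ δ hγ hx hx' hδ μ
    · simp; positivity
  -- off-diagonal part
  have hoff : ‖d1Sym s μ * conj (d1Sym s ν) * ((1 / (tauX s x * x μ * x ν) : ℝ) : ℂ)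
        - d1Sym s μ * conj (d1Sym s ν) * ((1 / (tauX s x' * x' μ * x' ν) : ℝ) : ℂ)‖ ≤ 3 / γ ^ 6 * δ := by
    rw [← mul_sub, ← Complex.ofReal_sub, norm_mul, norm_mul, Complex.norm_conj, Complex.norm_real,
      Real.norm_eq_abs, coeff_eq_sig s x hΔ.ne' μ ν, coeff_eq_sig s x' hΔ.ne' μ ν, ← sub_div, abs_div,
      abs_of_pos hΔ]
    have hL := sig_lipschitz (aW s) x x' γ δ hγ hγ1 ha0 ha1 hx hx' hδ μ ν
    calc ‖d1Sym s μ‖ * ‖d1Sym s ν‖ * (|sig (aW s) x μ ν - sig (aW s) x' μ ν| / Delta1r 0 s)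
        ≤ Delta1r 0 s * ((3 / γ ^ 6 * δ) / Delta1r 0 s) := by
          refine mul_le_mul (norm_d1Sym_mul_le s μ ν) ?_ (by positivity) hΔ.le
          exact div_le_div_of_nonneg_right hL hΔ.le
      _ = 3 / γ ^ 6 * δ := by field_simp
  unfold Emat
  calc ‖(if μ = ν then (((1 / x μ : ℝ)) : ℂ) else 0)
          - d1Sym s μ * conj (d1Sym s ν) * ((1 / (tauX s x * x μ * x ν) : ℝ) : ℂ)
        - ((if μ = ν then (((1 / x' μ : ℝ)) : ℂ) else 0)
          - d1Sym s μ * conj (d1Sym s ν) * ((1 / (tauX s x' * x' μ * x' ν) : ℝ) : ℂ))‖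
      = ‖((if μ = ν then (((1 / x μ : ℝ)) : ℂ) else 0) - (if μ = ν then (((1 / x' μ : ℝ)) : ℂ) else 0))
          - (d1Sym s μ * conj (d1Sym s ν) * ((1 / (tauX s x * x μ * x ν) : ℝ) : ℂ)
            - d1Sym s μ * conj (d1Sym s ν) * ((1 / (tauX s x' * x' μ * x' ν) : ℝ) : ℂ))‖ := by
        congr 1; ring
    _ ≤ 1 / γ ^ 2 * δ + 3 / γ ^ 6 * δ := le_trans (norm_sub_le _ _) (add_le_add hdiag hoff)
    _ = (1 / γ ^ 2 + 3 / γ ^ 6) * δ := by ring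

end EMatrix

/-! ## §2 Quadratic forms: `E ≥ 0`, `E ≤ diag(1/x)`, and the weighted Lagrange identity -/

section Forms

/-- the quadratic form `⟨w, A w⟩ = Σ_{μν} conj(w_μ) A_{μν} w_ν` of a `d × d` complex matrix. [folklore] -/
def qform (A : Matrix (Fin d) (Fin d) ℂ) (w : Fin d → ℂ) : ℂ := ∑ μ, ∑ ν, conj (w μ) * A μ ν * w ν

/-- the linear functional `L(w) := Σ_ν conj ∂¹_ν(p′)·w_ν/x_ν` of the rank-one part. [folklore] -/
def Lfun (s x : Fin d → ℝ) (w : Fin d → ℂ) : ℂ := ∑ ν, conj (d1Sym s ν) * w ν * ((1 / x ν : ℝ) : ℂ)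

/-- the diagonal part `P(w) := Σ_μ |w_μ|²/x_μ` as a complex number. [folklore] -/
theorem qform_diag (x : Fin d → ℝ) (w : Fin d → ℂ) :
    (∑ μ, ∑ ν, conj (w μ) * (if μ = ν then (((1 / x μ : ℝ)) : ℂ) else 0) * w ν)
      = ∑ μ, conj (w μ) * w μ * ((1 / x μ : ℝ) : ℂ) := by
  refine Finset.sum_congr rfl fun μ _ => ?_
  simp only [mul_ite, mul_zero, ite_mul, zero_mul, Finset.sum_ite_eq, Finset.mem_univ, if_true]
  ring

/-- **(Q1)** `⟨w, E(x)w⟩ = Σ_μ |w_μ|²/x_μ − |L(w)|²/τ`. [folklore] -/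
theorem qform_Emat (s x : Fin d → ℝ) (w : Fin d → ℂ) :
    qform (Emat s x) w
      = (∑ μ, conj (w μ) * w μ * ((1 / x μ : ℝ) : ℂ))
          - conj (Lfun s x w) * Lfun s x w * ((1 / tauX s x : ℝ) : ℂ) := by
  unfold qform Emat
  have hsplit : ∀ μ ν, conj (w μ) * ((if μ = ν then (((1 / x μ : ℝ)) : ℂ) else 0)
        - d1Sym s μ * conj (d1Sym s ν) * ((1 / (tauX s x * x μ * x ν) : ℝ) : ℂ)) * w ν
      = conj (w μ) * (if μ = ν then (((1 / x μ : ℝ)) : ℂ) else 0) * w ν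
        - (conj (w μ) * d1Sym s μ * ((1 / x μ : ℝ) : ℂ))
          * (conj (d1Sym s ν) * w ν * ((1 / x ν : ℝ) : ℂ)) * ((1 / tauX s x : ℝ) : ℂ) := by
    intro μ ν
    have : ((1 / (tauX s x * x μ * x ν) : ℝ) : ℂ)
        = ((1 / x μ : ℝ) : ℂ) * ((1 / x ν : ℝ) : ℂ) * ((1 / tauX s x : ℝ) : ℂ) := by
      push_cast; ring
    rw [this]; ring
  simp_rw [hsplit]
  simp only [Finset.sum_sub_distrib]
  rw [qform_diag]
  congr 1
  have hL : conj (Lfun s x w) = ∑ μ, conj (w μ) * d1Sym s μ * ((1 / x μ : ℝ) : ℂ) := by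
    unfold Lfun
    rw [map_sum]
    refine Finset.sum_congr rfl fun μ _ => ?_
    simp only [map_mul, Complex.conj_conj, Complex.conj_ofReal]
    ring
  rw [hL]
  unfold Lfun
  rw [Finset.sum_mul_sum, Finset.sum_mul]
  refine Finset.sum_congr rfl fun μ _ => ?_
  rw [Finset.sum_mul]

/-- **(Q2) the weighted Lagrange identity**:
`Σ_{μν} |∂_μ w_ν − ∂_ν w_μ|²/(x_μ x_ν) = 2·(τ·Σ_μ|w_μ|²/x_μ − |L(w)|²)` (as complex numbers; `τ = Σ|∂_λ|²/x_λ`).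
[folklore] -/
theorem lagrange_weighted (s x : Fin d → ℝ) (w : Fin d → ℂ) :
    (∑ μ, ∑ ν, conj (d1Sym s μ * w ν - d1Sym s ν * w μ) * (d1Sym s μ * w ν - d1Sym s ν * w μ)
        * (((1 / x μ : ℝ) : ℂ) * ((1 / x ν : ℝ) : ℂ)))
      = 2 * ((tauX s x : ℂ) * (∑ μ, conj (w μ) * w μ * ((1 / x μ : ℝ) : ℂ))
          - conj (Lfun s x w) * Lfun s x w) := by
  -- the four pieces
  set A : Fin d → ℂ := fun μ => conj (d1Sym s μ) * d1Sym s μ * ((1 / x μ : ℝ) : ℂ) with hA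
  set B : Fin d → ℂ := fun μ => conj (w μ) * w μ * ((1 / x μ : ℝ) : ℂ) with hB
  set C : Fin d → ℂ := fun μ => conj (w μ) * d1Sym s μ * ((1 / x μ : ℝ) : ℂ) with hC
  set D : Fin d → ℂ := fun μ => conj (d1Sym s μ) * w μ * ((1 / x μ : ℝ) : ℂ) with hD
  have hsummand : ∀ μ ν, conj (d1Sym s μ * w ν - d1Sym s ν * w μ) * (d1Sym s μ * w ν - d1Sym s ν * w μ)
        * (((1 / x μ : ℝ) : ℂ) * ((1 / x ν : ℝ) : ℂ))
      = (A μ * B ν + A ν * B μ) - (C μ * D ν + C ν * D μ) := by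
    intro μ ν
    simp only [hA, hB, hC, hD, map_sub, map_mul]
    ring
  simp_rw [hsummand]
  simp only [Finset.sum_sub_distrib, Finset.sum_add_distrib]
  have hswap : ∀ f g : Fin d → ℂ, ∑ μ, ∑ ν, f ν * g μ = (∑ μ, f μ) * ∑ μ, g μ := by
    intro f g
    rw [Finset.sum_comm, Finset.sum_mul_sum]
  have hstraight : ∀ f g : Fin d → ℂ, ∑ μ, ∑ ν, f μ * g ν = (∑ μ, f μ) * ∑ μ, g μ := by
    intro f g
    rw [Finset.sum_mul_sum]
  rw [hstraight A B, hswap A B, hstraight C D, hswap C D]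
  have hτ : (tauX s x : ℂ) = ∑ μ, A μ := by
    unfold tauX
    push_cast
    refine Finset.sum_congr rfl fun μ _ => ?_
    simp only [hA]
    rw [← norm_d1Sym_sq, ← Complex.normSq_eq_norm_sq, Complex.normSq_eq_conj_mul_self]
    push_cast; ring
  have hL : conj (Lfun s x w) = ∑ μ, C μ := by
    unfold Lfun
    rw [map_sum]
    refine Finset.sum_congr rfl fun μ _ => ?_
    simp only [hC, map_mul, Complex.conj_conj, Complex.conj_ofReal]
    ring
  have hL' : Lfun s x w = ∑ μ, D μ := rfl
  rw [hτ, hL, hL']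
  ring

/-- **`⟨w, E(x)w⟩` in Lagrange form**: `⟨w,E(x)w⟩ = (2τ)⁻¹·Σ_{μν}|∂_μw_ν − ∂_νw_μ|²/(x_μx_ν)` (real number cast),
for `τ ≠ 0`. [folklore] -/
theorem qform_Emat_lagrange (s x : Fin d → ℝ) (w : Fin d → ℂ) (hτ : tauX s x ≠ 0) :
    qform (Emat s x) w
      = ((1 / (2 * tauX s x) * ∑ μ, ∑ ν, ‖d1Sym s μ * w ν - d1Sym s ν * w μ‖ ^ 2 / (x μ * x ν) : ℝ) : ℂ) := by
  have conj_mul_self_eq : ∀ z : ℂ, conj z * z = ((‖z‖ ^ 2 : ℝ) : ℂ) := fun z => by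
    rw [← Complex.normSq_eq_norm_sq, Complex.normSq_eq_conj_mul_self]
  have hQ2 := lagrange_weighted s x w
  have hcast : ((∑ μ, ∑ ν, ‖d1Sym s μ * w ν - d1Sym s ν * w μ‖ ^ 2 / (x μ * x ν) : ℝ) : ℂ)
      = ∑ μ, ∑ ν, conj (d1Sym s μ * w ν - d1Sym s ν * w μ) * (d1Sym s μ * w ν - d1Sym s ν * w μ)
        * (((1 / x μ : ℝ) : ℂ) * ((1 / x ν : ℝ) : ℂ)) := by
    push_cast
    refine Finset.sum_congr rfl fun μ _ => Finset.sum_congr rfl fun ν _ => ?_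
    rw [conj_mul_self_eq]; push_cast; ring
  rw [qform_Emat, Complex.ofReal_mul, hcast, hQ2]
  have hτc : (tauX s x : ℂ) ≠ 0 := Complex.ofReal_ne_zero.mpr hτ
  push_cast
  field_simp

/-- the quadratic form of `E` is REAL and NONNEGATIVE on the box (`τ > 0`, `x_λ > 0`): `E(p′;x) ≥ 0`. [folklore] -/
theorem qform_Emat_nonneg (s x : Fin d → ℝ) (w : Fin d → ℂ) (hτ : 0 < tauX s x) (hx : ∀ κ, 0 < x κ) :
    0 ≤ (qform (Emat s x) w).re ∧ (qform (Emat s x) w).im = 0 := by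
  rw [qform_Emat_lagrange s x w hτ.ne', Complex.ofReal_re, Complex.ofReal_im]
  refine ⟨mul_nonneg (by positivity) (Finset.sum_nonneg fun μ _ => Finset.sum_nonneg fun ν _ => ?_), rfl⟩
  exact div_nonneg (sq_nonneg _) (mul_pos (hx μ) (hx ν)).le

/-- … and BOUNDED ABOVE by the diagonal: `⟨w,E(x)w⟩ ≤ Σ_μ |w_μ|²/x_μ`, i.e. `E(p′;x) ≤ diag(1/x)`
(drop `|L(w)|²/τ ≥ 0`). [folklore] -/
theorem qform_Emat_le (s x : Fin d → ℝ) (w : Fin d → ℂ) (hτ : 0 < tauX s x) :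
    (qform (Emat s x) w).re ≤ ∑ μ, ‖w μ‖ ^ 2 / x μ := by
  have conj_mul_self_eq : ∀ z : ℂ, conj z * z = ((‖z‖ ^ 2 : ℝ) : ℂ) := fun z => by
    rw [← Complex.normSq_eq_norm_sq, Complex.normSq_eq_conj_mul_self]
  rw [qform_Emat, Complex.sub_re]
  have hP : (∑ μ, conj (w μ) * w μ * ((1 / x μ : ℝ) : ℂ)).re = ∑ μ, ‖w μ‖ ^ 2 / x μ := by
    rw [Complex.re_sum]
    refine Finset.sum_congr rfl fun μ _ => ?_
    rw [conj_mul_self_eq, ← Complex.ofReal_mul, Complex.ofReal_re]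
    ring
  have hLL : (conj (Lfun s x w) * Lfun s x w * ((1 / tauX s x : ℝ) : ℂ)).re
      = ‖Lfun s x w‖ ^ 2 / tauX s x := by
    rw [conj_mul_self_eq, ← Complex.ofReal_mul, Complex.ofReal_re]
    ring
  rw [hP, hLL]
  have : 0 ≤ ‖Lfun s x w‖ ^ 2 / tauX s x := div_nonneg (sq_nonneg _) hτ.le
  linarith

end Forms


/-! ## §3 (1.99): `QGQ*` per fibre, its `E`-representation, (1.100), (1.101) -/

section QGQ

/-- **`σ₉₉(p′) := Σ_λ |∂¹_λ(p′)|²/φ_λ(p′)`** — the momentum symbol of the scalar operator `∂₁*φ⁻¹∂₁` inverted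
in (1.99), and the function inside the `p′`-factor `a⁻¹(Σ_λ |∂_{1,λ}(p′)|²/φ_λ(p′))⁻¹` of (1.83) (`φ_λ` = (1.84) =
`B5Prop11Leaves.phiMu`). [cite: Balaban1984PropagatorsI, (1.83) p.31, (1.99) p.34] -/
def sigma199 (n : ℕ) [NeZero n] (a : ℝ) (s : Fin d → ℝ) : ℝ := ∑ κ, S1r (s κ) / phiMu n a κ s

/-- **(1.99) TRANSCRIBED PER FIBRE `p′ ≠ 0`** (unit lattice, `U = 1`): the printed
«QGQ* = a⁻¹I − a⁻¹φ⁻¹ + a⁻¹φ⁻¹∂₁(∂₁*φ⁻¹∂₁)⁻¹∂₁*φ⁻¹» read in the momentum representation in which (1.84) and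
(1.101) are printed: `φ` acts on the `μ`-th component as the multiplier `φ_μ(p′)` (1.84), `∂₁` (scalar → vector)
has the symbol `(∂¹_μ(p′))_μ`, `∂₁*` the conjugate symbol, so `∂₁*φ⁻¹∂₁` is the scalar multiplier `σ₉₉(p′)` and
`(QGQ*)(p′)_{μν} = a⁻¹δ_{μν} − a⁻¹δ_{μν}φ_μ⁻¹ + a⁻¹φ_μ⁻¹∂¹_μ σ₉₉⁻¹ conj ∂¹_ν φ_ν⁻¹` — three terms, in the printed
order.  The operator `QGQ*` on `T_η`/`T₁^{(k)}` itself is NOT constructed here (fibre matrices only).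
[cite: Balaban1984PropagatorsI, (1.99) p.34] -/
def qgq (n : ℕ) [NeZero n] (a : ℝ) (s : Fin d → ℝ) : Matrix (Fin d) (Fin d) ℂ := fun μ ν =>
  ((a⁻¹ : ℝ) : ℂ) * (if μ = ν then (1 : ℂ) else 0)
    - ((a⁻¹ : ℝ) : ℂ) * (if μ = ν then ((1 / phiMu n a μ s : ℝ) : ℂ) else 0)
    + ((a⁻¹ : ℝ) : ℂ) * (((1 / phiMu n a μ s : ℝ) : ℂ) * d1Sym s μ * ((1 / sigma199 n a s : ℝ) : ℂ)
        * conj (d1Sym s ν) * ((1 / phiMu n a ν s : ℝ) : ℂ))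

variable (n : ℕ) [NeZero n]

/-- `φ_μ > 0` for `a ≥ 0` (`φ_μ ≥ 1`, tree). [folklore] -/
theorem phiMu_pos (a : ℝ) (ha : 0 ≤ a) (μ : Fin d) (s : Fin d → ℝ) : 0 < phiMu n a μ s :=
  lt_of_lt_of_le one_pos (one_le_phiMu n a ha μ s)

/-- `σ₉₉(p′) > 0` on the punctured zone (`a ≥ 0`): the term `λ = ν₀` is positive. [folklore] -/
theorem sigma199_pos (a : ℝ) (ha : 0 ≤ a) (s : Fin d → ℝ) (hs : ∀ κ, |s κ| ≤ π) (ν₀ : Fin d)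
    (hν₀ : s ν₀ ≠ 0) : 0 < sigma199 n a s := by
  unfold sigma199
  have hterm : ∀ κ, 0 ≤ S1r (s κ) / phiMu n a κ s :=
    fun κ => div_nonneg (S1r_nonneg _) (phiMu_pos n a ha κ s).le
  have h0 : 0 < S1r (s ν₀) / phiMu n a ν₀ s := div_pos (S1r_pos (hs ν₀) hν₀) (phiMu_pos n a ha ν₀ s)
  exact lt_of_lt_of_le h0
    (Finset.single_le_sum (f := fun κ => S1r (s κ) / phiMu n a κ s) (fun κ _ => hterm κ)
      (Finset.mem_univ ν₀))

/-- the box variable in terms of (1.84): `z_μ = Δ₀φ_μ/(Δ₀ + a)` (since `Δ₀ + a·Δ₀φ^{(1.62)} = Δ₀·φ^{(1.84)}`).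
[folklore] -/
theorem zIn_eq_phiMu (hn : 1 ≤ n) (a : ℝ) (s : Fin d → ℝ) (hs : ∀ κ, |s κ| ≤ π) (μ : Fin d) :
    zIn n a s μ = Delta1r 0 s * phiMu n a μ s / (Delta1r 0 s + a) := by
  unfold zIn xIn
  rw [phiMu_eq_one_add n hn a μ s hs]
  ring

/-- **`1/φ_μ^{(1.84)} = (Δ₀/(Δ₀+a))·z_μ⁻¹`** on the punctured zone (`a ≥ 0`). [folklore] -/
theorem inv_phiMu_eq (hn : 1 ≤ n) (a : ℝ) (ha : 0 ≤ a) (s : Fin d → ℝ) (hs : ∀ κ, |s κ| ≤ π)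
    (ν₀ : Fin d) (hν₀ : s ν₀ ≠ 0) (μ : Fin d) :
    1 / phiMu n a μ s = Delta1r 0 s / (Delta1r 0 s + a) * (1 / zIn n a s μ) := by
  have hΔ := Delta1r_pos s hs ν₀ hν₀
  have hD : Delta1r 0 s + a ≠ 0 := by linarith
  have hφ := (phiMu_pos n a ha μ s).ne'
  rw [zIn_eq_phiMu n hn a s hs μ]
  field_simp

/-- `τ(p′; z) = ((Δ₀+a)/Δ₀)·σ₉₉(p′)` on the punctured zone. [folklore] -/
theorem tauX_zIn (hn : 1 ≤ n) (a : ℝ) (ha : 0 ≤ a) (s : Fin d → ℝ) (hs : ∀ κ, |s κ| ≤ π)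
    (ν₀ : Fin d) (hν₀ : s ν₀ ≠ 0) :
    tauX s (zIn n a s) = (Delta1r 0 s + a) / Delta1r 0 s * sigma199 n a s := by
  have hΔ := Delta1r_pos s hs ν₀ hν₀
  have hD : Delta1r 0 s + a ≠ 0 := by linarith
  unfold tauX sigma199
  rw [Finset.mul_sum]
  refine Finset.sum_congr rfl fun κ _ => ?_
  have hφ := (phiMu_pos n a ha κ s).ne'
  rw [zIn_eq_phiMu n hn a s hs κ]
  field_simp

/-- the rank-one coefficient of (1.99) in the box variable:
`φ_μ⁻¹·σ₉₉⁻¹·φ_ν⁻¹ = (Δ₀/(Δ₀+a))·(τ(z) z_μ z_ν)⁻¹`. [folklore] -/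
theorem coeff199_eq (hn : 1 ≤ n) (a : ℝ) (ha : 0 ≤ a) (s : Fin d → ℝ) (hs : ∀ κ, |s κ| ≤ π)
    (ν₀ : Fin d) (hν₀ : s ν₀ ≠ 0) (μ ν : Fin d) :
    1 / phiMu n a μ s * (1 / sigma199 n a s) * (1 / phiMu n a ν s)
      = Delta1r 0 s / (Delta1r 0 s + a) * (1 / (tauX s (zIn n a s) * zIn n a s μ * zIn n a s ν)) := by
  have hΔ := Delta1r_pos s hs ν₀ hν₀
  have hD : Delta1r 0 s + a ≠ 0 := by linarith
  have hσ := (sigma199_pos n a ha s hs ν₀ hν₀).ne'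
  have hφμ := (phiMu_pos n a ha μ s).ne'
  have hφν := (phiMu_pos n a ha ν s).ne'
  rw [tauX_zIn n hn a ha s hs ν₀ hν₀, zIn_eq_phiMu n hn a s hs μ, zIn_eq_phiMu n hn a s hs ν]
  field_simp

/-- **THE `E`-REPRESENTATION OF (1.99)**: `QGQ*(p′) = a⁻¹·(I − (Δ₀/(Δ₀+a))·E(p′; z(p′)))` on the punctured
zone, `a ≥ 0` — the Landau-gauge multiplier is an affine image of the SAME matrix function `E` whose value at
`x = Δ₀φ^{(1.62)}` carries (1.66) (§4).  Kernel-checked algebra; printed nowhere. [folklore] -/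
theorem qgq_eq_Emat (hn : 1 ≤ n) (a : ℝ) (ha : 0 ≤ a) (s : Fin d → ℝ) (hs : ∀ κ, |s κ| ≤ π)
    (ν₀ : Fin d) (hν₀ : s ν₀ ≠ 0) :
    qgq n a s = ((a⁻¹ : ℝ) : ℂ) •
      ((1 : Matrix (Fin d) (Fin d) ℂ) - ((Delta1r 0 s / (Delta1r 0 s + a) : ℝ) : ℂ) • Emat s (zIn n a s)) := by
  ext μ ν
  have e1 := inv_phiMu_eq n hn a ha s hs ν₀ hν₀ μ
  have e2 := coeff199_eq n hn a ha s hs ν₀ hν₀ μ ν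
  simp only [qgq, Emat, Matrix.smul_apply, Matrix.sub_apply, Matrix.one_apply, smul_eq_mul]
  have e3 : ((1 / phiMu n a μ s : ℝ) : ℂ) * d1Sym s μ * ((1 / sigma199 n a s : ℝ) : ℂ)
        * conj (d1Sym s ν) * ((1 / phiMu n a ν s : ℝ) : ℂ)
      = d1Sym s μ * conj (d1Sym s ν)
        * (((1 / phiMu n a μ s) * (1 / sigma199 n a s) * (1 / phiMu n a ν s) : ℝ) : ℂ) := by
    push_cast; ring
  rw [e3, e2, e1]
  push_cast
  split_ifs <;> ring

/-- `QGQ*(p′)` is Hermitian. [folklore] -/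
theorem qgq_conjTranspose (hn : 1 ≤ n) (a : ℝ) (ha : 0 ≤ a) (s : Fin d → ℝ) (hs : ∀ κ, |s κ| ≤ π)
    (ν₀ : Fin d) (hν₀ : s ν₀ ≠ 0) : (qgq n a s)ᴴ = qgq n a s := by
  rw [qgq_eq_Emat n hn a ha s hs ν₀ hν₀, Matrix.conjTranspose_smul, Matrix.conjTranspose_sub,
    Matrix.conjTranspose_smul, Matrix.conjTranspose_one, Emat_conjTranspose]
  simp only [Complex.star_def, Complex.conj_ofReal]

/-! ### quadratic forms of affine images -/

/-- `⟨w, (rA)w⟩ = r⟨w, Aw⟩`. [folklore] -/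
theorem qform_smul (r : ℂ) (A : Matrix (Fin d) (Fin d) ℂ) (w : Fin d → ℂ) :
    qform (r • A) w = r * qform A w := by
  unfold qform
  simp only [Matrix.smul_apply, smul_eq_mul, Finset.mul_sum]
  refine Finset.sum_congr rfl fun μ _ => Finset.sum_congr rfl fun ν _ => ?_
  ring

/-- `⟨w, (A − B)w⟩ = ⟨w, Aw⟩ − ⟨w, Bw⟩`. [folklore] -/
theorem qform_sub (A B : Matrix (Fin d) (Fin d) ℂ) (w : Fin d → ℂ) :
    qform (A - B) w = qform A w - qform B w := by
  unfold qform
  simp only [Matrix.sub_apply, mul_sub, sub_mul, Finset.sum_sub_distrib]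

/-- `⟨w, (A + B)w⟩ = ⟨w, Aw⟩ + ⟨w, Bw⟩`. [folklore] -/
theorem qform_add (A B : Matrix (Fin d) (Fin d) ℂ) (w : Fin d → ℂ) :
    qform (A + B) w = qform A w + qform B w := by
  unfold qform
  simp only [Matrix.add_apply, mul_add, add_mul, Finset.sum_add_distrib]

/-- `⟨w, I w⟩ = Σ_μ |w_μ|²` (real cast). [folklore] -/
theorem qform_one (w : Fin d → ℂ) :
    qform (1 : Matrix (Fin d) (Fin d) ℂ) w = ((∑ μ, ‖w μ‖ ^ 2 : ℝ) : ℂ) := by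
  have conj_mul_self_eq : ∀ z : ℂ, conj z * z = ((‖z‖ ^ 2 : ℝ) : ℂ) := fun z => by
    rw [← Complex.normSq_eq_norm_sq, Complex.normSq_eq_conj_mul_self]
  unfold qform
  rw [Complex.ofReal_sum]
  refine Finset.sum_congr rfl fun μ _ => ?_
  simp only [Matrix.one_apply, mul_ite, mul_one, mul_zero, ite_mul, zero_mul, Finset.sum_ite_eq,
    Finset.mem_univ, if_true]
  rw [conj_mul_self_eq]

/-- **`⟨w, QGQ*(p′) w⟩ = a⁻¹·(Σ|w_μ|² − (Δ₀/(Δ₀+a))·⟨w, E(z)w⟩)`**, and it is real. [folklore] -/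
theorem qform_qgq_re (hn : 1 ≤ n) (a : ℝ) (ha : 0 ≤ a) (s : Fin d → ℝ) (hs : ∀ κ, |s κ| ≤ π)
    (ν₀ : Fin d) (hν₀ : s ν₀ ≠ 0) (w : Fin d → ℂ) :
    (qform (qgq n a s) w).re
        = a⁻¹ * ((∑ μ, ‖w μ‖ ^ 2) - Delta1r 0 s / (Delta1r 0 s + a) * (qform (Emat s (zIn n a s)) w).re)
      ∧ (qform (qgq n a s) w).im = 0 := by
  have hΔ := Delta1r_pos s hs ν₀ hν₀
  have hz := zIn_mem_box n hn a ha s hs ν₀ hν₀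
  have hzpos : ∀ κ, 0 < zIn n a s κ := fun κ => lt_of_lt_of_le (gam0_pos d) (hz κ).1
  have hτ := (tauX_pos (gam0_pos d) s (zIn n a s) hΔ hz).2
  obtain ⟨_, him⟩ := qform_Emat_nonneg s (zIn n a s) w hτ hzpos
  have hQ : qform (Emat s (zIn n a s)) w = (((qform (Emat s (zIn n a s)) w).re : ℝ) : ℂ) := by
    apply Complex.ext <;> simp [him]
  rw [qgq_eq_Emat n hn a ha s hs ν₀ hν₀, qform_smul, qform_sub, qform_smul, qform_one, hQ]
  set q : ℝ := (qform (Emat s (zIn n a s)) w).re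
  have : ((a⁻¹ : ℝ) : ℂ) * (((∑ μ, ‖w μ‖ ^ 2 : ℝ) : ℂ)
        - ((Delta1r 0 s / (Delta1r 0 s + a) : ℝ) : ℂ) * ((q : ℝ) : ℂ))
      = ((a⁻¹ * ((∑ μ, ‖w μ‖ ^ 2) - Delta1r 0 s / (Delta1r 0 s + a) * q) : ℝ) : ℂ) := by
    push_cast; ring
  rw [this, Complex.ofReal_re, Complex.ofReal_im]
  exact ⟨rfl, rfl⟩

/-- **(1.100), UPPER HALF, per fibre**: «QGQ* ≦ a⁻¹I» — `⟨w, QGQ*(p′)w⟩ ≤ a⁻¹Σ_μ|w_μ|²` for every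
`w ∈ ℂ^d`, `p′ ≠ 0`, `a > 0` (from `E ≥ 0`); printed as the upper half of (1.100), [B5] p.34. [folklore] -/
theorem ineq1100_upper (hn : 1 ≤ n) (a : ℝ) (ha : 0 < a) (s : Fin d → ℝ) (hs : ∀ κ, |s κ| ≤ π)
    (ν₀ : Fin d) (hν₀ : s ν₀ ≠ 0) (w : Fin d → ℂ) :
    (qform (qgq n a s) w).re ≤ a⁻¹ * ∑ μ, ‖w μ‖ ^ 2 := by
  have hΔ := Delta1r_pos s hs ν₀ hν₀
  have hz := zIn_mem_box n hn a ha.le s hs ν₀ hν₀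
  have hzpos : ∀ κ, 0 < zIn n a s κ := fun κ => lt_of_lt_of_le (gam0_pos d) (hz κ).1
  have hτ := (tauX_pos (gam0_pos d) s (zIn n a s) hΔ hz).2
  obtain ⟨hq, _⟩ := qform_Emat_nonneg s (zIn n a s) w hτ hzpos
  rw [(qform_qgq_re n hn a ha.le s hs ν₀ hν₀ w).1]
  have hc : 0 ≤ Delta1r 0 s / (Delta1r 0 s + a) := div_nonneg hΔ.le (by linarith)
  have hai : 0 ≤ a⁻¹ := inv_nonneg.mpr ha.le
  nlinarith [mul_nonneg hc hq]

/-- **(1.100), LOWER HALF, per fibre**: «a⁻¹(φ − 1)φ⁻¹ ≦ QGQ*» —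
`a⁻¹Σ_μ(1 − φ_μ(p′)⁻¹)|w_μ|² ≤ ⟨w, QGQ*(p′)w⟩` (from `E(z) ≤ diag(1/z)` and `(Δ₀/(Δ₀+a))/z_μ = φ_μ⁻¹`);
printed as the lower half of (1.100), [B5] p.34. [folklore] -/
theorem ineq1100_lower (hn : 1 ≤ n) (a : ℝ) (ha : 0 < a) (s : Fin d → ℝ) (hs : ∀ κ, |s κ| ≤ π)
    (ν₀ : Fin d) (hν₀ : s ν₀ ≠ 0) (w : Fin d → ℂ) :
    a⁻¹ * ∑ μ, (1 - 1 / phiMu n a μ s) * ‖w μ‖ ^ 2 ≤ (qform (qgq n a s) w).re := by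
  have hΔ := Delta1r_pos s hs ν₀ hν₀
  have hz := zIn_mem_box n hn a ha.le s hs ν₀ hν₀
  have hτ := (tauX_pos (gam0_pos d) s (zIn n a s) hΔ hz).2
  have hle := qform_Emat_le s (zIn n a s) w hτ
  rw [(qform_qgq_re n hn a ha.le s hs ν₀ hν₀ w).1]
  have hc : 0 ≤ Delta1r 0 s / (Delta1r 0 s + a) := div_nonneg hΔ.le (by linarith)
  have hai : 0 ≤ a⁻¹ := inv_nonneg.mpr ha.le
  have hsum : ∑ μ, (1 - 1 / phiMu n a μ s) * ‖w μ‖ ^ 2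
      = (∑ μ, ‖w μ‖ ^ 2) - Delta1r 0 s / (Delta1r 0 s + a) * ∑ μ, ‖w μ‖ ^ 2 / zIn n a s μ := by
    rw [Finset.mul_sum, ← Finset.sum_sub_distrib]
    refine Finset.sum_congr rfl fun μ _ => ?_
    rw [inv_phiMu_eq n hn a ha.le s hs ν₀ hν₀ μ]
    ring
  rw [hsum]
  nlinarith [mul_le_mul_of_nonneg_left hle hc]

/-- **(1.101)**: the multiplier of `a⁻¹(φ − 1)/φ` on the `μ`-th component,
`m_μ(p′) := a⁻¹(φ_μ(p′) − 1)/φ_μ(p′)`. [cite: Balaban1984PropagatorsI, (1.101) p.34] -/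
def m101 (a : ℝ) (μ : Fin d) (s : Fin d → ℝ) : ℝ := a⁻¹ * (phiMu n a μ s - 1) / phiMu n a μ s

/-- **(1.101) verbatim** «a⁻¹(φ_μ(p′) − 1)/φ_μ(p′) = Σ_{l′}|u(p′+l′)|²|v_μ(p′+l′)|²Δ₀(p′)/Δ(p′+l′) / (Δ₀(p′) +
aΣ_{l′}|u(p′+l′)|²|v_μ(p′+l′)|²Δ₀(p′)/Δ(p′+l′))»: with `Σ_{l′}|u|²|v_μ|²Δ₀/Δ = Δ₀φ_μ^{(1.62)} = xIn`,
`m_μ = xIn_μ/(Δ₀ + a·xIn_μ)` on the zone, `a ≠ 0` (the printed identity (1.101), [B5] p.34, in the tree's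
variables). [folklore] -/
theorem m101_eq (hn : 1 ≤ n) (a : ℝ) (ha : 0 < a) (μ : Fin d) (s : Fin d → ℝ) (hs : ∀ κ, |s κ| ≤ π)
    (ν₀ : Fin d) (hν₀ : s ν₀ ≠ 0) :
    m101 n a μ s = xIn n s μ / (Delta1r 0 s + a * xIn n s μ) := by
  have hΔ := Delta1r_pos s hs ν₀ hν₀
  have hφ := (phiMu_pos n a ha.le μ s).ne'
  have hφ' := phi162_nonneg n μ s
  unfold m101 xIn
  rw [phiMu_eq_one_add n hn a μ s hs] at hφ ⊢
  field_simp
  ring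

/-- **(1.101)'s two-sided bounds** «bounded from below and above by positive constants dependent on d only (for
a = 1)», made explicit: `γ₀/(4d + a) ≤ m_μ(p′) ≤ 1/(Δ₀(p′) + a) ≤ 1/a` on the punctured zone,
`a > 0`, `γ₀ = (4/π²)^{d+2}` (constants ours; the printed sentence follows (1.101), [B5] p.34). [folklore] -/
theorem m101_bounds (hn : 1 ≤ n) (a : ℝ) (ha : 0 < a) (μ : Fin d) (s : Fin d → ℝ) (hs : ∀ κ, |s κ| ≤ π)
    (ν₀ : Fin d) (hν₀ : s ν₀ ≠ 0) :
    gam0 d / (4 * d + a) ≤ m101 n a μ s ∧ m101 n a μ s ≤ 1 / (Delta1r 0 s + a)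
      ∧ 1 / (Delta1r 0 s + a) ≤ 1 / a := by
  have hΔ := Delta1r_pos s hs ν₀ hν₀
  have h4 := Delta1r_le s
  obtain ⟨hlo, hhi⟩ := xIn_mem_box n hn s hs ν₀ hν₀ μ
  have hγ := gam0_pos d
  have hγ1 := gam0_le_one d
  rw [m101_eq n hn a ha μ s hs ν₀ hν₀]
  have hD : 0 < Delta1r 0 s + a * xIn n s μ := by nlinarith
  refine ⟨?_, ?_, ?_⟩
  · rw [div_le_div_iff₀ (by positivity) hD]
    nlinarith [mul_nonneg ha.le (sub_nonneg.mpr hlo), mul_nonneg ha.le hγ.le]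
  · rw [div_le_div_iff₀ hD (by linarith)]
    nlinarith
  · exact one_div_le_one_div_of_le ha (by linarith)

/-- **η-RATE OF (1.101)**: `|m_μ^{(N)}(p′) − m_μ^{(RN)}(p′)| ≤ (π²/12 + 1/3)·N⁻²` — `a`-FREE
(`m = y/(Δ₀+ay)`, `|m − m′| ≤ Δ₀|y − y′|/Δ₀² ≤ C_φN⁻²` by gen-1 `Delta0_phi162_rate`).  Printed nowhere.
[folklore] -/
theorem m101_rate {N R : ℕ} [NeZero N] [NeZero R] (hN : 1 ≤ N) (hR : 1 ≤ R) (a : ℝ) (ha : 0 < a)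
    (μ : Fin d) (s : Fin d → ℝ) (hs : ∀ κ, |s κ| ≤ π) (ν₀ : Fin d) (hν₀ : s ν₀ ≠ 0) :
    |m101 N a μ s - m101 (R * N) a μ s| ≤ Cphi * ((N : ℝ) ^ 2)⁻¹ := by
  haveI : NeZero (R * N) := ⟨Nat.mul_ne_zero (NeZero.ne R) (NeZero.ne N)⟩
  have hRN : 1 ≤ R * N := Nat.one_le_iff_ne_zero.mpr (NeZero.ne (R * N))
  have hΔ := Delta1r_pos s hs ν₀ hν₀
  obtain ⟨hlo, _⟩ := xIn_mem_box N hN s hs ν₀ hν₀ μ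
  obtain ⟨hlo', _⟩ := xIn_mem_box (R * N) hRN s hs ν₀ hν₀ μ
  have hγ := gam0_pos d
  have hrate := Delta0_phi162_rate hN hR μ s hs ν₀ hν₀
  rw [m101_eq N hN a ha μ s hs ν₀ hν₀, m101_eq (R * N) hRN a ha μ s hs ν₀ hν₀]
  set y := xIn N s μ with hy
  set y' := xIn (R * N) s μ with hy'
  have hypos : 0 < y := lt_of_lt_of_le hγ hlo
  have hy'pos : 0 < y' := lt_of_lt_of_le hγ hlo'
  have hD : 0 < Delta1r 0 s + a * y := by nlinarith
  have hD' : 0 < Delta1r 0 s + a * y' := by nlinarith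
  have hdiff : y / (Delta1r 0 s + a * y) - y' / (Delta1r 0 s + a * y')
      = Delta1r 0 s * (y - y') / ((Delta1r 0 s + a * y) * (Delta1r 0 s + a * y')) := by
    field_simp; ring
  rw [hdiff, abs_div, abs_mul, abs_of_pos hΔ, abs_of_pos (mul_pos hD hD')]
  -- |y - y'| ≤ Δ₀ C N⁻² (the rate is stated for Δ₀φ = xIn)
  have hyy : |y - y'| ≤ Delta1r 0 s * (Cphi * ((N : ℝ) ^ 2)⁻¹) := by
    rw [abs_sub_comm]; exact hrate
  have hden : Delta1r 0 s * Delta1r 0 s ≤ (Delta1r 0 s + a * y) * (Delta1r 0 s + a * y') := by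
    nlinarith [mul_nonneg ha.le hypos.le, mul_nonneg ha.le hy'pos.le,
      mul_nonneg (mul_nonneg ha.le hypos.le) (mul_nonneg ha.le hy'pos.le)]
  have hC : 0 ≤ Cphi * ((N : ℝ) ^ 2)⁻¹ := by have := Cphi_pos; positivity
  calc Delta1r 0 s * |y - y'| / ((Delta1r 0 s + a * y) * (Delta1r 0 s + a * y'))
      ≤ Delta1r 0 s * (Delta1r 0 s * (Cphi * ((N : ℝ) ^ 2)⁻¹)) / (Delta1r 0 s * Delta1r 0 s) := by
        refine div_le_div₀ (by positivity) (mul_le_mul_of_nonneg_left hyy hΔ.le) (by positivity) hden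
    _ = Cphi * ((N : ℝ) ^ 2)⁻¹ := by field_simp

end QGQ

/-! ## §4 The inverse `(QGQ*)⁻¹ = a·I + D_k`, explicit and kernel-checked -/

section Inverse

/-- `τ_φ(p′) := Σ_λ |∂¹_λ(p′)|²/φ_λ^{(1.62)}(p′)` (`= τ(p′; Δ₀φ)·Δ₀ = Δ₀²·Σ_λ a_λ/(Δ₀φ_λ)`). [folklore] -/
def tauPhi (n : ℕ) (s : Fin d → ℝ) : ℝ := ∑ κ, S1r (s κ) / phi162 n κ s

/-- **`D_k(p′)_{μν} := δ_{μν}/φ_μ^{(1.62)}(p′) − ∂¹_μ(p′) conj ∂¹_ν(p′)·w^{(1.66)}_{μν}(p′)`** — the fibre matrix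
whose quadratic form is the printed integrand of (1.66) (§6: `⟨w, D_k w⟩ = ½Σ_{μν} w_{μν}|∂_μw_ν − ∂_νw_μ|²`,
`w_{μν}` = `B5Bounds167Lattice.w166`). [folklore] -/
def DeltaKfib (n : ℕ) (s : Fin d → ℝ) : Matrix (Fin d) (Fin d) ℂ := fun μ ν =>
  (if μ = ν then ((1 / phi162 n μ s : ℝ) : ℂ) else 0)
    - d1Sym s μ * conj (d1Sym s ν) * ((w166 n μ ν s : ℝ) : ℂ)

/-- **`(QGQ*)⁻¹(p′) := a·I + D_k(p′)`** — the CANDIDATE inverse; that it IS the inverse of the transcribed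
(1.99) is `qgq_mul_qgqInv` / `qgqInv_mul_qgq` below. [folklore] -/
def qgqInv (n : ℕ) (a : ℝ) (s : Fin d → ℝ) : Matrix (Fin d) (Fin d) ℂ :=
  ((a : ℝ) : ℂ) • (1 : Matrix (Fin d) (Fin d) ℂ) + DeltaKfib n s

/-- the entries of `(QGQ*)⁻¹(p′)`: `δ_{μν}(a + 1/φ_μ^{(1.62)}) − ∂¹_μ conj ∂¹_ν · w^{(1.66)}_{μν}`. [folklore] -/
theorem qgqInv_apply (n : ℕ) (a : ℝ) (s : Fin d → ℝ) (μ ν : Fin d) :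
    qgqInv n a s μ ν = (if μ = ν then ((a + 1 / phi162 n μ s : ℝ) : ℂ) else 0)
      - d1Sym s μ * conj (d1Sym s ν) * ((w166 n μ ν s : ℝ) : ℂ) := by
  simp only [qgqInv, DeltaKfib, Matrix.add_apply, Matrix.smul_apply, Matrix.one_apply, smul_eq_mul]
  split_ifs <;> push_cast <;> ring

/-- `w^{(1.66)}_{μν} = (τ_φ φ_μ φ_ν)⁻¹` off `Δ₀ = 0` (pull `Δ₀⁻²` out of the sum in `w166`). [folklore] -/
theorem w166_eq_tauPhi (n : ℕ) (s : Fin d → ℝ) (hΔ : Delta1r 0 s ≠ 0) (μ ν : Fin d) :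
    w166 n μ ν s = 1 / (tauPhi n s * phi162 n μ s * phi162 n ν s) := by
  unfold w166 tauPhi
  have hsum : ∑ κ, ‖d1Sym s κ‖ ^ 2 / (Delta1r 0 s ^ 2 * phi162 n κ s)
      = (∑ κ, S1r (s κ) / phi162 n κ s) / Delta1r 0 s ^ 2 := by
    rw [Finset.sum_div]
    refine Finset.sum_congr rfl fun κ _ => ?_
    rw [norm_d1Sym_sq, div_div, mul_comm]
  rw [hsum]
  congr 1
  field_simp

variable (n : ℕ) [NeZero n]

/-- **`D_k(p′) = Δ₀(p′)·E(p′; Δ₀φ^{(1.62)}(p′))`** on the punctured zone — (1.66)'s fibre matrix is the value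
of `E` at the first box variable (`w166 = σ(a_·; x)` is the sibling's `w166_eq_sig`). [folklore] -/
theorem DeltaKfib_eq_Emat (hn : 1 ≤ n) (s : Fin d → ℝ) (hs : ∀ κ, |s κ| ≤ π) (ν₀ : Fin d)
    (hν₀ : s ν₀ ≠ 0) : DeltaKfib n s = ((Delta1r 0 s : ℝ) : ℂ) • Emat s (xIn n s) := by
  have hΔ := Delta1r_pos s hs ν₀ hν₀
  ext μ ν
  simp only [DeltaKfib, Emat, Matrix.smul_apply, smul_eq_mul]
  have hoff : w166 n μ ν s = Delta1r 0 s * (1 / (tauX s (xIn n s) * xIn n s μ * xIn n s ν)) := by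
    rw [coeff_eq_sig s (xIn n s) hΔ.ne' μ ν, w166_eq_sig]
    field_simp
  have hdiag : 1 / phi162 n μ s = Delta1r 0 s * (1 / xIn n s μ) := by
    have hφ := (phi162_pos n hn s hs ν₀ hν₀ μ).ne'
    unfold xIn
    field_simp
  rw [hoff, hdiag]
  push_cast
  split_ifs <;> ring

/-! ### a Sherman–Morrison identity for diagonal-plus-rank-one matrices -/

/-- **Sherman–Morrison, explicit**: for `m_κ ≠ 0`, `σ ≠ 0`, `σ′ := σ + Σ_κ c_κ b_κ/m_κ ≠ 0`,
`(diag(m) + b cᵀ/σ)·(diag(m)⁻¹ − (b/m)(c/m)ᵀ/σ′) = I`. [folklore] -/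
theorem sm_mul_eq_one (m b c : Fin d → ℂ) (σ σ' : ℂ) (hm : ∀ κ, m κ ≠ 0) (hσ : σ ≠ 0) (hσ' : σ' ≠ 0)
    (hrel : σ' = σ + ∑ κ, c κ * b κ / m κ) :
    (Matrix.of fun μ κ => (if μ = κ then m μ else 0) + b μ * c κ / σ) *
        (Matrix.of fun κ ν => (if κ = ν then (m κ)⁻¹ else 0) - b κ / m κ * (c ν / m ν) / σ')
      = (1 : Matrix (Fin d) (Fin d) ℂ) := by
  ext μ ν
  rw [Matrix.mul_apply, Matrix.one_apply]
  simp only [Matrix.of_apply]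
  have hsum : ∀ κ, ((if μ = κ then m μ else 0) + b μ * c κ / σ)
        * ((if κ = ν then (m κ)⁻¹ else 0) - b κ / m κ * (c ν / m ν) / σ')
      = (if μ = κ then m μ else 0) * (if κ = ν then (m κ)⁻¹ else 0)
        - (if μ = κ then m μ else 0) * (b κ / m κ * (c ν / m ν) / σ')
        + (if κ = ν then (m κ)⁻¹ else 0) * (b μ * c κ / σ)
        - (c κ * b κ / m κ) * (b μ * (c ν / m ν) / (σ * σ')) := by
    intro κ; ring
  simp_rw [hsum]
  simp only [Finset.sum_sub_distrib, Finset.sum_add_distrib, ← Finset.sum_mul]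
  have hS : ∑ κ, c κ * b κ / m κ = σ' - σ := by rw [hrel]; ring
  rw [hS]
  simp only [ite_mul, zero_mul, mul_ite, mul_zero, Finset.sum_ite_eq, Finset.sum_ite_eq',
    Finset.mem_univ, if_true]
  by_cases h : μ = ν
  · subst h
    have hmμ := hm μ
    simp only [if_true]
    field_simp
    ring
  · have hmμ := hm μ
    have hmν := hm ν
    simp only [h, if_false]
    field_simp
    ring

/-- **`τ_φ/a = σ₉₉ + Σ_κ |∂_κ|² φ_κ⁻²/(1 − φ_κ⁻¹)`** — the Sherman–Morrison denominator of (1.99)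
(`φ = 1 + aφ^{(1.62)}`). [folklore] -/
theorem sm_denominator (hn : 1 ≤ n) (a : ℝ) (ha : 0 < a) (s : Fin d → ℝ) (hs : ∀ κ, |s κ| ≤ π)
    (ν₀ : Fin d) (hν₀ : s ν₀ ≠ 0) :
    tauPhi n s / a
      = sigma199 n a s + ∑ κ, S1r (s κ) * (1 / phiMu n a κ s) ^ 2 / (1 - 1 / phiMu n a κ s) := by
  unfold tauPhi sigma199
  rw [← Finset.sum_add_distrib, Finset.sum_div]
  refine Finset.sum_congr rfl fun κ _ => ?_
  have hφ62 := phi162_pos n hn s hs ν₀ hν₀ κ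
  have hφ : phiMu n a κ s = 1 + a * phi162 n κ s := phiMu_eq_one_add n hn a κ s hs
  have h1 : (1 + a * phi162 n κ s) ≠ 0 := by positivity
  have h2 : 1 - 1 / (1 + a * phi162 n κ s) = a * phi162 n κ s / (1 + a * phi162 n κ s) := by
    field_simp; ring
  rw [hφ, h2]
  have h3 : a * phi162 n κ s ≠ 0 := by positivity
  field_simp
  ring

/-- **`QGQ*(p′) · (a·I + D_k(p′)) = I`** for every `p′ ≠ 0` in the zone and every `a > 0`: the matrix
`a·I + D_k(p′)` IS `(QGQ*)⁻¹(p′)` of (1.102)–(1.103) for the transcribed (1.99) (Sherman–Morrison with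
`m_μ = 1 − φ_μ⁻¹`, `b = ∂¹φ⁻¹`, `c = conj ∂¹ φ⁻¹`, `σ = σ₉₉`, `σ′ = τ_φ/a`).  Kernel cross-check of two printed
formulas ((1.99) and the weight of (1.66)); printed nowhere. [folklore] -/
theorem qgq_mul_qgqInv (hn : 1 ≤ n) (a : ℝ) (ha : 0 < a) (s : Fin d → ℝ) (hs : ∀ κ, |s κ| ≤ π)
    (ν₀ : Fin d) (hν₀ : s ν₀ ≠ 0) : qgq n a s * qgqInv n a s = 1 := by
  have conj_mul_self_eq : ∀ z : ℂ, conj z * z = ((‖z‖ ^ 2 : ℝ) : ℂ) := fun z => by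
    rw [← Complex.normSq_eq_norm_sq, Complex.normSq_eq_conj_mul_self]
  have hΔ := Delta1r_pos s hs ν₀ hν₀
  have hσr := sigma199_pos n a ha.le s hs ν₀ hν₀
  have hφ62 := phi162_pos n hn s hs ν₀ hν₀
  have hφeq : ∀ κ, phiMu n a κ s = 1 + a * phi162 n κ s := fun κ => phiMu_eq_one_add n hn a κ s hs
  -- τ_φ > 0
  have hτr : 0 < tauPhi n s := by
    unfold tauPhi
    have hterm : ∀ κ, 0 ≤ S1r (s κ) / phi162 n κ s := fun κ => div_nonneg (S1r_nonneg _) (hφ62 κ).le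
    exact lt_of_lt_of_le (div_pos (S1r_pos (hs ν₀) hν₀) (hφ62 ν₀))
      (Finset.single_le_sum (f := fun κ => S1r (s κ) / phi162 n κ s) (fun κ _ => hterm κ)
        (Finset.mem_univ ν₀))
  -- the Sherman–Morrison data
  set m : Fin d → ℂ := fun κ => ((1 - 1 / phiMu n a κ s : ℝ) : ℂ) with hm
  set b : Fin d → ℂ := fun κ => d1Sym s κ * ((1 / phiMu n a κ s : ℝ) : ℂ) with hb
  set c : Fin d → ℂ := fun κ => conj (d1Sym s κ) * ((1 / phiMu n a κ s : ℝ) : ℂ) with hc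
  set σ : ℂ := ((sigma199 n a s : ℝ) : ℂ) with hσ
  set σ' : ℂ := ((tauPhi n s / a : ℝ) : ℂ) with hσ'
  have hmr : ∀ κ, 1 - 1 / phiMu n a κ s = a * phi162 n κ s / (1 + a * phi162 n κ s) := by
    intro κ; rw [hφeq κ]
    have : (1 + a * phi162 n κ s) ≠ 0 := by have := hφ62 κ; positivity
    field_simp; ring
  have hmpos : ∀ κ, 0 < 1 - 1 / phiMu n a κ s := by
    intro κ; rw [hmr κ]; have := hφ62 κ; positivity
  have hmne : ∀ κ, m κ ≠ 0 := fun κ => by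
    simp only [hm]; exact Complex.ofReal_ne_zero.mpr (hmpos κ).ne'
  have hσne : σ ≠ 0 := Complex.ofReal_ne_zero.mpr hσr.ne'
  have hσ'ne : σ' ≠ 0 := Complex.ofReal_ne_zero.mpr (div_pos hτr ha).ne'
  have hrel : σ' = σ + ∑ κ, c κ * b κ / m κ := by
    have hterm : ∀ κ, c κ * b κ / m κ
        = ((S1r (s κ) * (1 / phiMu n a κ s) ^ 2 / (1 - 1 / phiMu n a κ s) : ℝ) : ℂ) := by
      intro κ
      simp only [hc, hb, hm]
      have hS : conj (d1Sym s κ) * d1Sym s κ = ((S1r (s κ) : ℝ) : ℂ) := by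
        rw [conj_mul_self_eq, norm_d1Sym_sq]
      push_cast
      rw [← norm_d1Sym_sq, ← conj_mul_self_eq]
      ring
    simp_rw [hterm]
    rw [hσ', hσ, sm_denominator n hn a ha s hs ν₀ hν₀]
    push_cast
    rfl
  have key := sm_mul_eq_one m b c σ σ' hmne hσne hσ'ne hrel
  -- identify the two factors
  have hL : qgq n a s = ((a⁻¹ : ℝ) : ℂ) •
      (Matrix.of fun μ κ => (if μ = κ then m μ else 0) + b μ * c κ / σ) := by
    ext μ κ
    simp only [qgq, Matrix.smul_apply, Matrix.of_apply, smul_eq_mul, hm, hb, hc, hσ]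
    push_cast
    split_ifs <;> ring
  have hR : qgqInv n a s = ((a : ℝ) : ℂ) •
      (Matrix.of fun κ ν => (if κ = ν then (m κ)⁻¹ else 0) - b κ / m κ * (c ν / m ν) / σ') := by
    ext κ ν
    rw [qgqInv_apply]
    simp only [Matrix.smul_apply, Matrix.of_apply, smul_eq_mul, hm, hb, hc, hσ']
    -- real identities
    have hi : a + 1 / phi162 n κ s = a * (1 / (1 - 1 / phiMu n a κ s)) := by
      rw [hmr κ]; have := hφ62 κ; field_simp; ring
    have hw : w166 n κ ν s = a * ((1 / phiMu n a κ s) / (1 - 1 / phiMu n a κ s)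
        * ((1 / phiMu n a ν s) / (1 - 1 / phiMu n a ν s)) / (tauPhi n s / a)) := by
      rw [w166_eq_tauPhi n s hΔ.ne' κ ν, hmr κ, hmr ν, hφeq κ, hφeq ν]
      have h1 := hφ62 κ; have h2 := hφ62 ν
      field_simp
    rw [hi, hw]
    push_cast
    split_ifs <;> ring
  rw [hL, hR, Matrix.smul_mul, Matrix.mul_smul, smul_smul, key]
  have ha' : ((a⁻¹ : ℝ) : ℂ) * ((a : ℝ) : ℂ) = 1 := by
    rw [← Complex.ofReal_mul, inv_mul_cancel₀ ha.ne', Complex.ofReal_one]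
  rw [ha', one_smul]

/-- … hence also `(a·I + D_k)·QGQ* = I` (square matrices over a field) and `(QGQ*)⁻¹ = a·I + D_k` as
`Matrix.inv`. [folklore] -/
theorem qgqInv_mul_qgq (hn : 1 ≤ n) (a : ℝ) (ha : 0 < a) (s : Fin d → ℝ) (hs : ∀ κ, |s κ| ≤ π)
    (ν₀ : Fin d) (hν₀ : s ν₀ ≠ 0) :
    qgqInv n a s * qgq n a s = 1 ∧ (qgq n a s)⁻¹ = qgqInv n a s := by
  have h := qgq_mul_qgqInv n hn a ha s hs ν₀ hν₀
  exact ⟨mul_eq_one_comm.mp h, Matrix.inv_eq_right_inv h⟩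

/-- **`(QGQ*)⁻¹ ≥ a·I` and `D_k ≥ 0` per fibre**: `a·Σ|w_μ|² ≤ ⟨w,(QGQ*)⁻¹(p′)w⟩` and
`0 ≤ ⟨w, D_k(p′)w⟩ ≤ Σ_μ |w_μ|²/φ_μ^{(1.62)}(p′)` (from `E ≥ 0`, `E ≤ diag(1/x)` at `x = Δ₀φ`). [folklore] -/
theorem qform_DeltaKfib_bounds (hn : 1 ≤ n) (s : Fin d → ℝ) (hs : ∀ κ, |s κ| ≤ π) (ν₀ : Fin d)
    (hν₀ : s ν₀ ≠ 0) (w : Fin d → ℂ) :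
    0 ≤ (qform (DeltaKfib n s) w).re ∧ (qform (DeltaKfib n s) w).im = 0
      ∧ (qform (DeltaKfib n s) w).re ≤ ∑ μ, ‖w μ‖ ^ 2 / phi162 n μ s := by
  have hΔ := Delta1r_pos s hs ν₀ hν₀
  have hx := xIn_mem_box n hn s hs ν₀ hν₀
  have hxpos : ∀ κ, 0 < xIn n s κ := fun κ => lt_of_lt_of_le (gam0_pos d) (hx κ).1
  have hτ := (tauX_pos (gam0_pos d) s (xIn n s) hΔ hx).2
  obtain ⟨hq, him⟩ := qform_Emat_nonneg s (xIn n s) w hτ hxpos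
  have hle := qform_Emat_le s (xIn n s) w hτ
  rw [DeltaKfib_eq_Emat n hn s hs ν₀ hν₀, qform_smul, Complex.re_ofReal_mul, Complex.im_ofReal_mul, him,
    mul_zero]
  refine ⟨mul_nonneg hΔ.le hq, rfl, ?_⟩
  calc Delta1r 0 s * (qform (Emat s (xIn n s)) w).re
      ≤ Delta1r 0 s * ∑ μ, ‖w μ‖ ^ 2 / xIn n s μ := mul_le_mul_of_nonneg_left hle hΔ.le
    _ = ∑ μ, ‖w μ‖ ^ 2 / phi162 n μ s := by
        rw [Finset.mul_sum]
        refine Finset.sum_congr rfl fun μ _ => ?_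
        have hφ := (phi162_pos n hn s hs ν₀ hν₀ μ).ne'
        unfold xIn
        field_simp

/-- **`(QGQ*)⁻¹(p′) ≥ a·I` per fibre**: `a·Σ_μ|w_μ|² ≤ ⟨w, (a·I + D_k(p′))w⟩`, and the form is real
(the inverse reading of the upper half of (1.100)). [folklore] -/
theorem qform_qgqInv_lower (hn : 1 ≤ n) (a : ℝ) (s : Fin d → ℝ) (hs : ∀ κ, |s κ| ≤ π) (ν₀ : Fin d)
    (hν₀ : s ν₀ ≠ 0) (w : Fin d → ℂ) :
    a * ∑ μ, ‖w μ‖ ^ 2 ≤ (qform (qgqInv n a s) w).re ∧ (qform (qgqInv n a s) w).im = 0 := by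
  obtain ⟨hq, him, _⟩ := qform_DeltaKfib_bounds n hn s hs ν₀ hν₀ w
  unfold qgqInv
  rw [qform_add, qform_smul, qform_one, Complex.add_re, Complex.add_im, ← Complex.ofReal_mul,
    Complex.ofReal_re, Complex.ofReal_im, him]
  exact ⟨by linarith, by simp⟩

end Inverse

/-! ## §5 η-rates of the scalar multipliers (1.84), (1.85), (1.86) and of `σ₉₉` -/

section ScalarRates

/-- bookkeeping: `R·N ≥ 1` and `NeZero (R·N)` for `N, R ≥ 1`. [folklore] -/
private theorem hRN_of {N R : ℕ} (hN : 1 ≤ N) (hR : 1 ≤ R) : NeZero (R * N) ∧ 1 ≤ R * N :=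
  ⟨⟨Nat.mul_ne_zero (by omega) (by omega)⟩,
    Nat.one_le_iff_ne_zero.mpr (Nat.mul_ne_zero (by omega) (by omega))⟩

variable {N R : ℕ} [NeZero N] [NeZero R]

/-- **η-RATE OF (1.84)**: `|φ_μ^{(N)}(p′) − φ_μ^{(RN)}(p′)| ≤ a·C_φ·N⁻²` on the zone (`φ = 1 + aφ^{(1.62)}`,
gen-1 `phi162_rate`). [folklore] -/
theorem phiMu_rate (hN : 1 ≤ N) (hR : 1 ≤ R) (a : ℝ) (ha : 0 ≤ a) (μ : Fin d) (s : Fin d → ℝ)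
    (hs : ∀ κ, |s κ| ≤ π) (ν₀ : Fin d) (hν₀ : s ν₀ ≠ 0) :
    haveI := (hRN_of hN hR).1
    |phiMu N a μ s - phiMu (R * N) a μ s| ≤ a * (Cphi * ((N : ℝ) ^ 2)⁻¹) := by
  obtain ⟨_, hRN⟩ := hRN_of (N := N) (R := R) hN hR
  rw [phiMu_eq_one_add N hN a μ s hs, phiMu_eq_one_add (R * N) hRN a μ s hs]
  have h := phi162_rate hN hR μ s hs ν₀ hν₀
  have : 1 + a * phi162 N μ s - (1 + a * phi162 (R * N) μ s)
      = a * (phi162 N μ s - phi162 (R * N) μ s) := by ring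
  rw [this, abs_mul, abs_of_nonneg ha, abs_sub_comm]
  exact mul_le_mul_of_nonneg_left h ha

/-- **η-RATE OF `φ_μ⁻¹`** (the diagonal factor of (1.83)/(1.99)): `|1/φ_μ^{(N)} − 1/φ_μ^{(RN)}| ≤ a·C_φ·N⁻²`
(`φ ≥ 1`). [folklore] -/
theorem inv_phiMu_rate (hN : 1 ≤ N) (hR : 1 ≤ R) (a : ℝ) (ha : 0 ≤ a) (μ : Fin d) (s : Fin d → ℝ)
    (hs : ∀ κ, |s κ| ≤ π) (ν₀ : Fin d) (hν₀ : s ν₀ ≠ 0) :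
    haveI := (hRN_of hN hR).1
    |1 / phiMu N a μ s - 1 / phiMu (R * N) a μ s| ≤ a * (Cphi * ((N : ℝ) ^ 2)⁻¹) := by
  obtain ⟨_, hRN⟩ := hRN_of (N := N) (R := R) hN hR
  have h1 := one_le_phiMu N a ha μ s
  have h2 := one_le_phiMu (R * N) a ha μ s
  calc |1 / phiMu N a μ s - 1 / phiMu (R * N) a μ s|
      ≤ 1 / (1 : ℝ) ^ 2 * |phiMu N a μ s - phiMu (R * N) a μ s| :=
        abs_inv_sub_inv_le 1 one_pos h1 h2
    _ ≤ a * (Cphi * ((N : ℝ) ^ 2)⁻¹) := by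
        rw [one_pow, div_one, one_mul]; exact phiMu_rate hN hR a ha μ s hs ν₀ hν₀

/-- **η-RATE OF (1.85)**: `|Δ₀φ_μ^{(N)}(p′) − Δ₀φ_μ^{(RN)}(p′)| ≤ a·Δ₀(p′)·C_φ·N⁻² ≤ 4d·a·C_φ·N⁻²`.
[folklore] -/
theorem Delta0_phiMu_rate (hN : 1 ≤ N) (hR : 1 ≤ R) (a : ℝ) (ha : 0 ≤ a) (μ : Fin d) (s : Fin d → ℝ)
    (hs : ∀ κ, |s κ| ≤ π) (ν₀ : Fin d) (hν₀ : s ν₀ ≠ 0) :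
    haveI := (hRN_of hN hR).1
    |Delta1r 0 s * phiMu N a μ s - Delta1r 0 s * phiMu (R * N) a μ s|
        ≤ a * (Delta1r 0 s * (Cphi * ((N : ℝ) ^ 2)⁻¹))
      ∧ a * (Delta1r 0 s * (Cphi * ((N : ℝ) ^ 2)⁻¹)) ≤ 4 * d * a * (Cphi * ((N : ℝ) ^ 2)⁻¹) := by
  obtain ⟨_, hRN⟩ := hRN_of (N := N) (R := R) hN hR
  have hΔ := Delta1r_pos s hs ν₀ hν₀
  have h4 := Delta1r_le s
  have hC : 0 ≤ Cphi * ((N : ℝ) ^ 2)⁻¹ := by have := Cphi_pos; positivity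
  refine ⟨?_, by nlinarith [mul_nonneg ha hC]⟩
  rw [← mul_sub, abs_mul, abs_of_pos hΔ]
  calc Delta1r 0 s * |phiMu N a μ s - phiMu (R * N) a μ s|
      ≤ Delta1r 0 s * (a * (Cphi * ((N : ℝ) ^ 2)⁻¹)) :=
        mul_le_mul_of_nonneg_left (phiMu_rate hN hR a ha μ s hs ν₀ hν₀) hΔ.le
    _ = a * (Delta1r 0 s * (Cphi * ((N : ℝ) ^ 2)⁻¹)) := by ring

variable (n : ℕ) [NeZero n]

/-- **(1.86) as a box mean**: `q₁₈₆(p′) := Σ_λ|∂_{1,λ}|²/(Δ₀²φ_λ) = (Σ_λ a_λ/z_λ)/(Δ₀ + a)` on the punctured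
zone, `a_λ = |∂¹_λ|²/Δ₀`, `z = Δ₀φ/(Δ₀+a) ∈ [γ₀,1]^d`; hence `(Δ₀+a)⁻¹ ≤ q₁₈₆ ≤ γ₀⁻¹(Δ₀+a)⁻¹` (the printed
«has the same property, hence also its inverse», p.32, with explicit constants). [folklore] -/
theorem q186_eq_mean (hn : 1 ≤ n) (a : ℝ) (ha : 0 ≤ a) (s : Fin d → ℝ) (hs : ∀ κ, |s κ| ≤ π)
    (ν₀ : Fin d) (hν₀ : s ν₀ ≠ 0) :
    q186 n a s = (∑ κ, aW s κ / zIn n a s κ) / (Delta1r 0 s + a)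
      ∧ 1 / (Delta1r 0 s + a) ≤ q186 n a s ∧ q186 n a s ≤ 1 / gam0 d * (1 / (Delta1r 0 s + a)) := by
  have hΔ := Delta1r_pos s hs ν₀ hν₀
  have hD : 0 < Delta1r 0 s + a := by linarith
  have hz := zIn_mem_box n hn a ha s hs ν₀ hν₀
  have heq : q186 n a s = (∑ κ, aW s κ / zIn n a s κ) / (Delta1r 0 s + a) := by
    unfold q186
    rw [Finset.sum_div]
    refine Finset.sum_congr rfl fun κ _ => ?_
    have hφ := (phiMu_pos n a ha κ s).ne'
    rw [zIn_eq_phiMu n hn a s hs κ]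
    unfold aW
    field_simp
  obtain ⟨hm1, hm2⟩ := mean_bounds (aW s) (zIn n a s) (gam0 d) (gam0_pos d) (aW_nonneg s)
    (sum_aW_eq_one s hΔ.ne') hz
  refine ⟨heq, ?_, ?_⟩
  · rw [heq]; exact div_le_div_of_nonneg_right hm1 hD.le
  · rw [heq, ← div_eq_mul_one_div]; exact div_le_div_of_nonneg_right hm2 hD.le

/-- `σ₉₉ = Δ₀²·q₁₈₆` (so the (1.83) factor `a⁻¹σ₉₉⁻¹` is `a⁻¹Δ₀⁻²q₁₈₆⁻¹`, its `Δ₀⁻²` being the printed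
regularisation (1.88)). [folklore] -/
theorem sigma199_eq_q186 (a : ℝ) (ha : 0 ≤ a) (s : Fin d → ℝ) (hs : ∀ κ, |s κ| ≤ π) (ν₀ : Fin d)
    (hν₀ : s ν₀ ≠ 0) : sigma199 n a s = Delta1r 0 s ^ 2 * q186 n a s := by
  have hΔ := (Delta1r_pos s hs ν₀ hν₀).ne'
  unfold sigma199 q186
  rw [Finset.mul_sum]
  refine Finset.sum_congr rfl fun κ _ => ?_
  have hφ := (phiMu_pos n a ha κ s).ne'
  field_simp

/-- **η-RATE OF (1.86) AND OF ITS INVERSE**: with `θ_z := (a/(Δ₀+a))·Δ₀·C_φ·N⁻²` (the rate of `z`),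
`|q₁₈₆^{(N)} − q₁₈₆^{(RN)}| ≤ γ₀⁻²θ_z/(Δ₀+a)` and `|1/q₁₈₆^{(N)} − 1/q₁₈₆^{(RN)}| ≤ (Δ₀+a)γ₀⁻²θ_z = γ₀⁻²·aΔ₀·C_φN⁻²
≤ 4d·a·γ₀⁻²C_φN⁻²` (sibling's `abs_mean_sub_mean_le` / `invMean_lipschitz` on the box). [folklore] -/
theorem q186_rate (hN : 1 ≤ N) (hR : 1 ≤ R) (a : ℝ) (ha : 0 ≤ a) (s : Fin d → ℝ) (hs : ∀ κ, |s κ| ≤ π)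
    (ν₀ : Fin d) (hν₀ : s ν₀ ≠ 0) :
    haveI := (hRN_of hN hR).1
    |q186 N a s - q186 (R * N) a s|
        ≤ 1 / gam0 d ^ 2 * (a / (Delta1r 0 s + a) * (Delta1r 0 s * (Cphi * ((N : ℝ) ^ 2)⁻¹)))
          / (Delta1r 0 s + a)
      ∧ |1 / q186 N a s - 1 / q186 (R * N) a s|
        ≤ 1 / gam0 d ^ 2 * (a * (Delta1r 0 s * (Cphi * ((N : ℝ) ^ 2)⁻¹)))
      ∧ 1 / gam0 d ^ 2 * (a * (Delta1r 0 s * (Cphi * ((N : ℝ) ^ 2)⁻¹)))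
        ≤ 4 * d * a * (1 / gam0 d ^ 2 * (Cphi * ((N : ℝ) ^ 2)⁻¹)) := by
  obtain ⟨_, hRN⟩ := hRN_of (N := N) (R := R) hN hR
  have hΔ := Delta1r_pos s hs ν₀ hν₀
  have hD : 0 < Delta1r 0 s + a := by linarith
  have h4 := Delta1r_le s
  have hγ := gam0_pos d
  have hz := zIn_mem_box N hN a ha s hs ν₀ hν₀
  have hz' := zIn_mem_box (R * N) hRN a ha s hs ν₀ hν₀
  have hθ := fun κ => zIn_rate hN hR a ha s hs ν₀ hν₀ κ
  set θ := a / (Delta1r 0 s + a) * (Delta1r 0 s * (Cphi * ((N : ℝ) ^ 2)⁻¹)) with hθdef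
  obtain ⟨heq, _, _⟩ := q186_eq_mean N hN a ha s hs ν₀ hν₀
  obtain ⟨heq', _, _⟩ := q186_eq_mean (R * N) hRN a ha s hs ν₀ hν₀
  have ha1 := sum_aW_eq_one s hΔ.ne'
  have hmean := abs_mean_sub_mean_le (aW s) (zIn N a s) (zIn (R * N) a s) (gam0 d) θ hγ (aW_nonneg s)
    ha1 hz hz' hθ
  have hinv := invMean_lipschitz (aW s) (zIn N a s) (zIn (R * N) a s) (gam0 d) θ hγ (aW_nonneg s)
    ha1 hz hz' hθ
  have hC : 0 ≤ Cphi * ((N : ℝ) ^ 2)⁻¹ := by have := Cphi_pos; positivity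
  refine ⟨?_, ?_, ?_⟩
  · rw [heq, heq', ← sub_div, abs_div, abs_of_pos hD]
    exact div_le_div_of_nonneg_right hmean hD.le
  · rw [heq, heq', one_div_div, one_div_div]
    have hm1 : 0 < ∑ κ, aW s κ / zIn N a s κ :=
      lt_of_lt_of_le one_pos (mean_bounds (aW s) (zIn N a s) (gam0 d) hγ (aW_nonneg s) ha1 hz).1
    have hm2 : 0 < ∑ κ, aW s κ / zIn (R * N) a s κ :=
      lt_of_lt_of_le one_pos (mean_bounds (aW s) (zIn (R * N) a s) (gam0 d) hγ (aW_nonneg s) ha1 hz').1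
    have hrew : (Delta1r 0 s + a) / ∑ κ, aW s κ / zIn N a s κ
          - (Delta1r 0 s + a) / ∑ κ, aW s κ / zIn (R * N) a s κ
        = (Delta1r 0 s + a) * (1 / ∑ κ, aW s κ / zIn N a s κ - 1 / ∑ κ, aW s κ / zIn (R * N) a s κ) := by
      field_simp
    calc |(Delta1r 0 s + a) / ∑ κ, aW s κ / zIn N a s κ
            - (Delta1r 0 s + a) / ∑ κ, aW s κ / zIn (R * N) a s κ|
        = (Delta1r 0 s + a) * |1 / ∑ κ, aW s κ / zIn N a s κ
            - 1 / ∑ κ, aW s κ / zIn (R * N) a s κ| := by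
          rw [hrew, abs_mul, abs_of_pos hD]
      _ ≤ (Delta1r 0 s + a) * (1 / gam0 d ^ 2 * θ) := mul_le_mul_of_nonneg_left hinv hD.le
      _ = 1 / gam0 d ^ 2 * (a * (Delta1r 0 s * (Cphi * ((N : ℝ) ^ 2)⁻¹))) := by
          rw [hθdef]; field_simp
  · have : a * Delta1r 0 s ≤ 4 * d * a := by nlinarith
    have hγ2 : 0 ≤ 1 / gam0 d ^ 2 := by positivity
    nlinarith [mul_nonneg hγ2 (mul_nonneg (mul_nonneg ha hΔ.le) hC), mul_nonneg hγ2 hC,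
      mul_le_mul_of_nonneg_right this (mul_nonneg hγ2 hC)]

/-- **η-RATE OF `σ₉₉⁻¹`'s regularised form `Δ₀²/σ₉₉ = 1/q₁₈₆`** — the scalar inverted in (1.99) and the middle
`p′`-factor of (1.83), at the printed regularisation (1.88): `≤ 4d·a·γ₀⁻²·C_φ·N⁻²`. [folklore] -/
theorem inv_sigma199_reg_rate (hN : 1 ≤ N) (hR : 1 ≤ R) (a : ℝ) (ha : 0 ≤ a) (s : Fin d → ℝ)
    (hs : ∀ κ, |s κ| ≤ π) (ν₀ : Fin d) (hν₀ : s ν₀ ≠ 0) :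
    haveI := (hRN_of hN hR).1
    |Delta1r 0 s ^ 2 / sigma199 N a s - Delta1r 0 s ^ 2 / sigma199 (R * N) a s|
      ≤ 4 * d * a * (1 / gam0 d ^ 2 * (Cphi * ((N : ℝ) ^ 2)⁻¹)) := by
  obtain ⟨_, hRN⟩ := hRN_of (N := N) (R := R) hN hR
  have hΔ := Delta1r_pos s hs ν₀ hν₀
  obtain ⟨_, h2, h3⟩ := q186_rate hN hR a ha s hs ν₀ hν₀
  have e1 : Delta1r 0 s ^ 2 / sigma199 N a s = 1 / q186 N a s := by
    rw [sigma199_eq_q186 N a ha s hs ν₀ hν₀]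
    have hq : q186 N a s ≠ 0 := by
      have := (q186_eq_mean N hN a ha s hs ν₀ hν₀).2.1
      have hD : 0 < 1 / (Delta1r 0 s + a) := by positivity
      exact (lt_of_lt_of_le hD this).ne'
    field_simp
  have e2 : Delta1r 0 s ^ 2 / sigma199 (R * N) a s = 1 / q186 (R * N) a s := by
    rw [sigma199_eq_q186 (R * N) a ha s hs ν₀ hν₀]
    have hq : q186 (R * N) a s ≠ 0 := by
      have := (q186_eq_mean (R * N) hRN a ha s hs ν₀ hν₀).2.1
      have hD : 0 < 1 / (Delta1r 0 s + a) := by positivity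
      exact (lt_of_lt_of_le hD this).ne'
    field_simp
  rw [e1, e2]
  exact h2.trans h3

end ScalarRates

/-! ## §6 Entry bounds and η-rates of the matrix multipliers `QGQ*`, `(QGQ*)⁻¹`, `D_k` -/

section MatrixRates

variable {N R : ℕ} [NeZero N] [NeZero R]

/-- the constant `C_E := γ₀⁻² + 3γ₀⁻⁶` — the box-Lipschitz constant of `E`. [folklore] -/
def CE (d : ℕ) : ℝ := 1 / gam0 d ^ 2 + 3 / gam0 d ^ 6

/-- `C_E > 0`. [folklore] -/
theorem CE_pos : 0 < CE d := by unfold CE; have := gam0_pos d; positivity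

variable (n : ℕ) [NeZero n]

/-- **UNIFORM ENTRY BOUNDS**: `‖QGQ*(p′)_{μν}‖ ≤ a⁻¹(1 + γ₀⁻¹ + γ₀⁻²)`, `‖D_k(p′)_{μν}‖ ≤ Δ₀(γ₀⁻¹ + γ₀⁻²) ≤
4d(γ₀⁻¹ + γ₀⁻²)`, `‖(QGQ*)⁻¹(p′)_{μν}‖ ≤ a + 4d(γ₀⁻¹ + γ₀⁻²)` — uniformly in `k` (= `n`) and `p′ ≠ 0`
(the printed «bounded from below and above by positive constants», p.34, entrywise with explicit constants).
[folklore] -/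
theorem norm_entries_le (hn : 1 ≤ n) (a : ℝ) (ha : 0 < a) (s : Fin d → ℝ) (hs : ∀ κ, |s κ| ≤ π)
    (ν₀ : Fin d) (hν₀ : s ν₀ ≠ 0) (μ ν : Fin d) :
    ‖qgq n a s μ ν‖ ≤ a⁻¹ * (1 + (1 / gam0 d + 1 / gam0 d ^ 2))
      ∧ ‖DeltaKfib n s μ ν‖ ≤ Delta1r 0 s * (1 / gam0 d + 1 / gam0 d ^ 2)
      ∧ ‖qgqInv n a s μ ν‖ ≤ a + 4 * d * (1 / gam0 d + 1 / gam0 d ^ 2) := by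
  have hΔ := Delta1r_pos s hs ν₀ hν₀
  have h4 := Delta1r_le s
  have hγ := gam0_pos d
  have hz := zIn_mem_box n hn a ha.le s hs ν₀ hν₀
  have hx := xIn_mem_box n hn s hs ν₀ hν₀
  have hEz := norm_Emat_le hγ s (zIn n a s) hΔ hz μ ν
  have hEx := norm_Emat_le hγ s (xIn n s) hΔ hx μ ν
  have hK : 0 ≤ 1 / gam0 d + 1 / gam0 d ^ 2 := by positivity
  have hc0 : 0 ≤ Delta1r 0 s / (Delta1r 0 s + a) := by positivity
  have hc1 : Delta1r 0 s / (Delta1r 0 s + a) ≤ 1 := by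
    rw [div_le_one (by linarith)]; linarith
  have hδ : ‖(if μ = ν then (1 : ℂ) else 0)‖ ≤ 1 := by split_ifs <;> simp
  -- D_k
  have hD : ‖DeltaKfib n s μ ν‖ ≤ Delta1r 0 s * (1 / gam0 d + 1 / gam0 d ^ 2) := by
    rw [DeltaKfib_eq_Emat n hn s hs ν₀ hν₀, Matrix.smul_apply, smul_eq_mul, norm_mul,
      Complex.norm_real, Real.norm_eq_abs, abs_of_pos hΔ]
    exact mul_le_mul_of_nonneg_left hEx hΔ.le
  refine ⟨?_, hD, ?_⟩
  · rw [qgq_eq_Emat n hn a ha.le s hs ν₀ hν₀, Matrix.smul_apply, smul_eq_mul, norm_mul,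
      Complex.norm_real, Real.norm_eq_abs, abs_of_pos (inv_pos.mpr ha), Matrix.sub_apply,
      Matrix.smul_apply, smul_eq_mul, Matrix.one_apply]
    refine mul_le_mul_of_nonneg_left ?_ (inv_pos.mpr ha).le
    calc ‖(if μ = ν then (1 : ℂ) else 0)
            - ((Delta1r 0 s / (Delta1r 0 s + a) : ℝ) : ℂ) * Emat s (zIn n a s) μ ν‖
        ≤ ‖(if μ = ν then (1 : ℂ) else 0)‖
            + ‖((Delta1r 0 s / (Delta1r 0 s + a) : ℝ) : ℂ) * Emat s (zIn n a s) μ ν‖ := norm_sub_le _ _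
      _ ≤ 1 + (1 / gam0 d + 1 / gam0 d ^ 2) := by
          refine add_le_add hδ ?_
          rw [norm_mul, Complex.norm_real, Real.norm_eq_abs, abs_of_nonneg hc0]
          calc Delta1r 0 s / (Delta1r 0 s + a) * ‖Emat s (zIn n a s) μ ν‖
              ≤ 1 * (1 / gam0 d + 1 / gam0 d ^ 2) := mul_le_mul hc1 hEz (norm_nonneg _) zero_le_one
            _ = _ := one_mul _
  · unfold qgqInv
    rw [Matrix.add_apply, Matrix.smul_apply, smul_eq_mul, Matrix.one_apply]
    calc ‖((a : ℝ) : ℂ) * (if μ = ν then (1 : ℂ) else 0) + DeltaKfib n s μ ν‖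
        ≤ ‖((a : ℝ) : ℂ) * (if μ = ν then (1 : ℂ) else 0)‖ + ‖DeltaKfib n s μ ν‖ := norm_add_le _ _
      _ ≤ a + Delta1r 0 s * (1 / gam0 d + 1 / gam0 d ^ 2) := by
          refine add_le_add ?_ hD
          rw [norm_mul, Complex.norm_real, Real.norm_eq_abs, abs_of_pos ha]
          calc a * ‖(if μ = ν then (1 : ℂ) else 0)‖ ≤ a * 1 := mul_le_mul_of_nonneg_left hδ ha.le
            _ = a := mul_one a
      _ ≤ a + 4 * d * (1 / gam0 d + 1 / gam0 d ^ 2) := by nlinarith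

/-- **η-RATE OF `D_k(p′)` = η-RATE OF `(QGQ*)⁻¹(p′)`** (the `a·I` cancels): entrywise
`‖D_k^{(N)}(p′)_{μν} − D_k^{(RN)}(p′)_{μν}‖ ≤ Δ₀(p′)²·C_E·C_φ·N⁻² ≤ 16d²·C_E·C_φ·N⁻²`, `a`-FREE, uniformly in
`p′ ≠ 0` — all `N, R ≥ 1` (`E` box-Lipschitz at `x = Δ₀φ^{(1.62)}`, gen-1 `Delta0_phi162_rate`). [folklore] -/
theorem qgqInv_rate (hN : 1 ≤ N) (hR : 1 ≤ R) (a : ℝ) (s : Fin d → ℝ) (hs : ∀ κ, |s κ| ≤ π) (ν₀ : Fin d)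
    (hν₀ : s ν₀ ≠ 0) (μ ν : Fin d) :
    ‖DeltaKfib N s μ ν - DeltaKfib (R * N) s μ ν‖
        ≤ Delta1r 0 s ^ 2 * (CE d * (Cphi * ((N : ℝ) ^ 2)⁻¹))
      ∧ ‖qgqInv N a s μ ν - qgqInv (R * N) a s μ ν‖ = ‖DeltaKfib N s μ ν - DeltaKfib (R * N) s μ ν‖
      ∧ Delta1r 0 s ^ 2 * (CE d * (Cphi * ((N : ℝ) ^ 2)⁻¹))
        ≤ 16 * d ^ 2 * (CE d * (Cphi * ((N : ℝ) ^ 2)⁻¹)) := by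
  haveI : NeZero (R * N) := ⟨Nat.mul_ne_zero (NeZero.ne R) (NeZero.ne N)⟩
  have hRN : 1 ≤ R * N := Nat.one_le_iff_ne_zero.mpr (NeZero.ne (R * N))
  have hΔ := Delta1r_pos s hs ν₀ hν₀
  have h4 := Delta1r_le s
  have hγ := gam0_pos d
  have hx := xIn_mem_box N hN s hs ν₀ hν₀
  have hx' := xIn_mem_box (R * N) hRN s hs ν₀ hν₀
  have hθ : ∀ κ, |xIn N s κ - xIn (R * N) s κ| ≤ Delta1r 0 s * (Cphi * ((N : ℝ) ^ 2)⁻¹) := by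
    intro κ; unfold xIn; rw [abs_sub_comm]; exact Delta0_phi162_rate hN hR κ s hs ν₀ hν₀
  have hE := Emat_lipschitz hγ (gam0_le_one d) s (xIn N s) (xIn (R * N) s) hΔ hx hx' hθ μ ν
  have hC : 0 ≤ CE d * (Cphi * ((N : ℝ) ^ 2)⁻¹) := by
    have := Cphi_pos; have := CE_pos (d := d); positivity
  refine ⟨?_, ?_, ?_⟩
  · rw [DeltaKfib_eq_Emat N hN s hs ν₀ hν₀, DeltaKfib_eq_Emat (R * N) hRN s hs ν₀ hν₀, Matrix.smul_apply,
      Matrix.smul_apply, smul_eq_mul, smul_eq_mul, ← mul_sub, norm_mul, Complex.norm_real,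
      Real.norm_eq_abs, abs_of_pos hΔ]
    calc Delta1r 0 s * ‖Emat s (xIn N s) μ ν - Emat s (xIn (R * N) s) μ ν‖
        ≤ Delta1r 0 s * ((1 / gam0 d ^ 2 + 3 / gam0 d ^ 6) * (Delta1r 0 s * (Cphi * ((N : ℝ) ^ 2)⁻¹))) :=
          mul_le_mul_of_nonneg_left hE hΔ.le
      _ = Delta1r 0 s ^ 2 * (CE d * (Cphi * ((N : ℝ) ^ 2)⁻¹)) := by unfold CE; ring
  · unfold qgqInv
    rw [Matrix.add_apply, Matrix.add_apply, add_sub_add_left_eq_sub]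
  · have h16 : Delta1r 0 s ^ 2 ≤ 16 * d ^ 2 := by nlinarith
    exact mul_le_mul_of_nonneg_right h16 hC

/-- **η-RATE OF `QGQ*(p′)`** (the transcribed (1.99)): entrywise
`‖QGQ*^{(N)}(p′)_{μν} − QGQ*^{(RN)}(p′)_{μν}‖ ≤ (Δ₀/(Δ₀+a))²·C_E·C_φ·N⁻² ≤ C_E·C_φ·N⁻²` — `a`-FREE and uniform
in `p′ ≠ 0`, all `a > 0`, `N, R ≥ 1` (`QGQ* = a⁻¹(I − (Δ₀/(Δ₀+a))E(z))`, `E` box-Lipschitz, rate of `z`; the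
`a⁻¹` is absorbed by the factor `a/(Δ₀+a)` of `θ_z`). [folklore] -/
theorem qgq_rate (hN : 1 ≤ N) (hR : 1 ≤ R) (a : ℝ) (ha : 0 < a) (s : Fin d → ℝ) (hs : ∀ κ, |s κ| ≤ π)
    (ν₀ : Fin d) (hν₀ : s ν₀ ≠ 0) (μ ν : Fin d) :
    haveI : NeZero (R * N) := ⟨Nat.mul_ne_zero (NeZero.ne R) (NeZero.ne N)⟩
    ‖qgq N a s μ ν - qgq (R * N) a s μ ν‖
        ≤ (Delta1r 0 s / (Delta1r 0 s + a)) ^ 2 * (CE d * (Cphi * ((N : ℝ) ^ 2)⁻¹))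
      ∧ (Delta1r 0 s / (Delta1r 0 s + a)) ^ 2 * (CE d * (Cphi * ((N : ℝ) ^ 2)⁻¹))
        ≤ CE d * (Cphi * ((N : ℝ) ^ 2)⁻¹) := by
  haveI : NeZero (R * N) := ⟨Nat.mul_ne_zero (NeZero.ne R) (NeZero.ne N)⟩
  have hRN : 1 ≤ R * N := Nat.one_le_iff_ne_zero.mpr (NeZero.ne (R * N))
  have hΔ := Delta1r_pos s hs ν₀ hν₀
  have hD : 0 < Delta1r 0 s + a := by linarith
  have hγ := gam0_pos d
  have hz := zIn_mem_box N hN a ha.le s hs ν₀ hν₀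
  have hz' := zIn_mem_box (R * N) hRN a ha.le s hs ν₀ hν₀
  have hθ := fun κ => zIn_rate hN hR a ha.le s hs ν₀ hν₀ κ
  have hE := Emat_lipschitz hγ (gam0_le_one d) s (zIn N a s) (zIn (R * N) a s) hΔ hz hz' hθ μ ν
  have hC : 0 ≤ CE d * (Cphi * ((N : ℝ) ^ 2)⁻¹) := by
    have := Cphi_pos; have := CE_pos (d := d); positivity
  have hc0 : 0 ≤ Delta1r 0 s / (Delta1r 0 s + a) := by positivity
  have hc1 : Delta1r 0 s / (Delta1r 0 s + a) ≤ 1 := by rw [div_le_one hD]; linarith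
  refine ⟨?_, ?_⟩
  · rw [qgq_eq_Emat N hN a ha.le s hs ν₀ hν₀, qgq_eq_Emat (R * N) hRN a ha.le s hs ν₀ hν₀]
    simp only [Matrix.smul_apply, Matrix.sub_apply, Matrix.one_apply, smul_eq_mul]
    have hrew : ((a⁻¹ : ℝ) : ℂ) * ((if μ = ν then (1 : ℂ) else 0)
            - ((Delta1r 0 s / (Delta1r 0 s + a) : ℝ) : ℂ) * Emat s (zIn N a s) μ ν)
          - ((a⁻¹ : ℝ) : ℂ) * ((if μ = ν then (1 : ℂ) else 0)
            - ((Delta1r 0 s / (Delta1r 0 s + a) : ℝ) : ℂ) * Emat s (zIn (R * N) a s) μ ν)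
        = ((a⁻¹ * (Delta1r 0 s / (Delta1r 0 s + a)) : ℝ) : ℂ)
            * (Emat s (zIn (R * N) a s) μ ν - Emat s (zIn N a s) μ ν) := by
      push_cast; ring
    rw [hrew, norm_mul, Complex.norm_real, Real.norm_eq_abs, abs_of_nonneg (by positivity),
      norm_sub_rev]
    calc a⁻¹ * (Delta1r 0 s / (Delta1r 0 s + a)) * ‖Emat s (zIn N a s) μ ν - Emat s (zIn (R * N) a s) μ ν‖
        ≤ a⁻¹ * (Delta1r 0 s / (Delta1r 0 s + a)) * ((1 / gam0 d ^ 2 + 3 / gam0 d ^ 6)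
            * (a / (Delta1r 0 s + a) * (Delta1r 0 s * (Cphi * ((N : ℝ) ^ 2)⁻¹)))) :=
          mul_le_mul_of_nonneg_left hE (by positivity)
      _ = (Delta1r 0 s / (Delta1r 0 s + a)) ^ 2 * (CE d * (Cphi * ((N : ℝ) ^ 2)⁻¹)) := by
          unfold CE; field_simp
  · calc (Delta1r 0 s / (Delta1r 0 s + a)) ^ 2 * (CE d * (Cphi * ((N : ℝ) ^ 2)⁻¹))
        ≤ 1 ^ 2 * (CE d * (Cphi * ((N : ℝ) ^ 2)⁻¹)) := by
          refine mul_le_mul_of_nonneg_right ?_ hC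
          exact pow_le_pow_left₀ hc0 hc1 2
      _ = _ := by rw [one_pow, one_mul]

end MatrixRates

/-! ## §7 The `p′`-factors of (1.63) and (1.83): all rates now unconditional -/

section Factors

variable {N R : ℕ} [NeZero N] [NeZero R]

/-- **THE TWO `p′`-FACTORS OF (1.63), UNCONDITIONALLY**: the sibling's conditional
`T4GaugeActionRate.inverse_factors_rate` (hypothesis `hφ` = a rate of `Δ₀φ^{(1.62)}`) with `hφ` DISCHARGED by
gen-1 `hphi_discharged`: for all `N, R ≥ 1`, `p′ ≠ 0` in the zone,
`|1/(Δ₀φ_μ^{(N)}) − 1/(Δ₀φ_μ^{(RN)})| ≤ γ₀⁻²·4d·C_φ·N⁻²` and the same for `(Σ_λ a_λ/(Δ₀φ_λ))⁻¹`. [folklore] -/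
theorem inverse_factors_rate_discharged (hN : 1 ≤ N) (hR : 1 ≤ R) (μ : Fin d) (s : Fin d → ℝ)
    (hs : ∀ κ, |s κ| ≤ π) (ν₀ : Fin d) (hν₀ : s ν₀ ≠ 0) :
    haveI : NeZero (R * N) := ⟨Nat.mul_ne_zero (NeZero.ne R) (NeZero.ne N)⟩
    |1 / xIn N s μ - 1 / xIn (R * N) s μ| ≤ 1 / gam0 d ^ 2 * (4 * d * (Cphi * ((N : ℝ) ^ 2)⁻¹))
      ∧ |1 / (∑ κ, aW s κ / xIn N s κ) - 1 / (∑ κ, aW s κ / xIn (R * N) s κ)|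
        ≤ 1 / gam0 d ^ 2 * (4 * d * (Cphi * ((N : ℝ) ^ 2)⁻¹)) := by
  haveI : NeZero (R * N) := ⟨Nat.mul_ne_zero (NeZero.ne R) (NeZero.ne N)⟩
  have hRN : 1 ≤ R * N := Nat.one_le_iff_ne_zero.mpr (NeZero.ne (R * N))
  exact inverse_factors_rate N (R * N) hN hRN μ s hs ν₀ hν₀ (hphi_discharged hN hR s hs ν₀ hν₀)

end Factors

/-! ## §8 The link with (1.66): `⟨B, Δ_kB⟩ = Σ_{p′ ≠ 0} ⟨B̂(p′), D_k(p′)B̂(p′)⟩` on the unit torus -/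

section Link

variable (n : ℕ) [NeZero n]

/-- **FIBRE IDENTITY**: for `p′ ≠ 0` in the zone and every `w ∈ ℂ^d`,
`⟨w, D_k(p′)w⟩ = ½Σ_{μν} w^{(1.66)}_{μν}(p′)|∂¹_μ(p′)w_ν − ∂¹_ν(p′)w_μ|²` — the integrand of the third expression
of (1.66) is the quadratic form of `D_k(p′) = (QGQ*)⁻¹(p′) − a·I` (Lagrange identity). [folklore] -/
theorem qform_DeltaKfib_eq (hn : 1 ≤ n) (s : Fin d → ℝ) (hs : ∀ κ, |s κ| ≤ π) (ν₀ : Fin d)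
    (hν₀ : s ν₀ ≠ 0) (w : Fin d → ℂ) :
    (qform (DeltaKfib n s) w).re
      = 1 / 2 * ∑ μ, ∑ ν, w166 n μ ν s * ‖d1Sym s μ * w ν - d1Sym s ν * w μ‖ ^ 2 := by
  have hΔ := Delta1r_pos s hs ν₀ hν₀
  have hx := xIn_mem_box n hn s hs ν₀ hν₀
  have hτ := (tauX_pos (gam0_pos d) s (xIn n s) hΔ hx).2
  rw [DeltaKfib_eq_Emat n hn s hs ν₀ hν₀, qform_smul, qform_Emat_lagrange s (xIn n s) w hτ.ne',
    ← Complex.ofReal_mul, Complex.ofReal_re, Finset.mul_sum, Finset.mul_sum, Finset.mul_sum]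
  refine Finset.sum_congr rfl fun μ _ => ?_
  rw [Finset.mul_sum, Finset.mul_sum, Finset.mul_sum]
  refine Finset.sum_congr rfl fun ν _ => ?_
  have hw : w166 n μ ν s = Delta1r 0 s * (1 / (tauX s (xIn n s) * xIn n s μ * xIn n s ν)) := by
    rw [coeff_eq_sig s (xIn n s) hΔ.ne' μ ν, w166_eq_sig]
    field_simp
  rw [hw]
  have hxμ := (lt_of_lt_of_le (gam0_pos d) (hx μ).1).ne'
  have hxν := (lt_of_lt_of_le (gam0_pos d) (hx ν).1).ne'
  field_simp

variable (M : Fin d → ℕ) [hM : ∀ μ, NeZero (M μ)]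

open Classical in
/-- **`⟨B, Δ_kB⟩^{(1.66)} = Σ_{p : p′ ≠ 0} ⟨B̂(p′), D_k(p′) B̂(p′)⟩`** on the unit torus `T_M`
(`B5Bounds167Lattice.formDk` with the unitary DFT `hat`): the class `p′ = 0` carries no weight
(`(∂₁B)~(0) = 0`), and on every other class the (1.66)-integrand is the fibre form of
`D_k(p′) = (QGQ*)⁻¹(p′) − a·I` — our multiplier-level reading of what stands behind (1.102)–(1.103) for the
transcribed (1.99), not a printed formula.  The OPERATOR statements (1.65) = (1.66) and (1.103) on `T₁^{(k)}`
are NOT claimed. [folklore] -/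
theorem formDk_eq_sum_fibre (hn : 1 ≤ n) (B : Tor M × Fin d → ℂ) :
    formDk n M B = ∑ p, if sOf M p = 0 then 0
      else (qform (DeltaKfib n (sOf M p)) (fun ν => hat M B ν p)).re := by
  unfold formDk
  rw [Finset.mul_sum]
  have hcomm : (∑ μ : Fin d, (1 / 2 : ℝ) * ∑ ν : Fin d, ∑ p : Tor M,
        w166 n μ ν (sOf M p) * ‖curlHat M B μ ν p‖ ^ 2)
      = ∑ p : Tor M, (1 / 2 : ℝ) * ∑ μ : Fin d, ∑ ν : Fin d,
        w166 n μ ν (sOf M p) * ‖curlHat M B μ ν p‖ ^ 2 := by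
    simp only [Finset.mul_sum]
    calc ∑ μ : Fin d, ∑ ν : Fin d, ∑ p : Tor M,
            (1 / 2 : ℝ) * (w166 n μ ν (sOf M p) * ‖curlHat M B μ ν p‖ ^ 2)
        = ∑ μ : Fin d, ∑ p : Tor M, ∑ ν : Fin d,
            (1 / 2 : ℝ) * (w166 n μ ν (sOf M p) * ‖curlHat M B μ ν p‖ ^ 2) :=
          Finset.sum_congr rfl fun μ _ => Finset.sum_comm
      _ = ∑ p : Tor M, ∑ μ : Fin d, ∑ ν : Fin d,
            (1 / 2 : ℝ) * (w166 n μ ν (sOf M p) * ‖curlHat M B μ ν p‖ ^ 2) := Finset.sum_comm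
  rw [hcomm]
  refine Finset.sum_congr rfl fun p _ => ?_
  split_ifs with hp
  · have h0 : ∀ μ ν, curlHat M B μ ν p = 0 := fun μ ν => curlHat_eq_zero_of M B μ ν p hp
    simp [h0]
  · obtain ⟨ν₀, hν₀⟩ := Function.ne_iff.mp hp
    rw [qform_DeltaKfib_eq n hn (sOf M p) (abs_sOf_le M p) ν₀ hν₀]
    rfl

end Link
end Literature.MathematicalPhysics.QuantumFieldTheory.Balaban1983to89.B5QGQ199Rate

end
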